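import Literature.Analysis.Approximation.MateNevaiBoundedVariation

/-!
# The Máté–Nevai bounded-variation theorem: proof of `MateNevaiBoundedVariation`

This file DISCHARGES the named fact
`Literature.Analysis.Approximation.MateNevaiBoundedVariation` (A. Máté, P. Nevai, *Orthogonal
polynomials and absolutely continuous measures*, Approximation Theory IV (1983) 611–617
[MateNevai1983]; quoted as Theorem 2.27 of W. Van Assche, *Asymptotics for orthogonal
polynomials*, LNM 1265 (1987) [VanAssche1987]):
`theorem MateNevaiBoundedVariation_holds : MateNevaiBoundedVariation` (at the end of the file).

**Statement.** `τ` a positive measure on `ℝ` with finite moments, `p_n` its orthonormal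
polynomials, `a_{n+1} = k_n / k_{n+1}`, `b_n = ∫ x p_n² dτ`. If `a_n → 1/2`, `b_n → 0` and
`Σ (|a_{n+1} - a_n| + |b_{n+1} - b_n|) < ∞`, then `τ|_{(-1,1)} = g dx` with `g` continuous and
strictly positive on `(-1, 1)`.

## The printed proof and the road taken here

Máté–Nevai's note and J. Dombrowski, P. Nevai, *Orthogonal polynomials, measures and recurrence
relations*, SIAM J. Math. Anal. 17 (1986) 752–759 [DombrowskiNevai1986] argue through the
Turán-type determinant (D–N (3)–(4))
`S_n(x) = a_{n+1}² [p_{n+1}² - (x - b_n)/a_{n+1} · p_n p_{n+1} + p_n²]`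
`= a_{n+1} [a_{n+1} p_n² - a_n p_{n+1} p_{n-1}]`,
a quadratic form in `(p_{n+1}, p_n)` which is positive definite for `|x| < 1` and `n` large
(D–N (5)–(6)), whose variation `S_{n+1} - S_n` is a combination of `Δa`, `Δb` times products of
two consecutive `p`'s (D–N proof of Lemma 1), so that bounded variation of `(a_n, b_n)` gives the
multiplicative estimate D–N (10), hence uniform two-sided bounds and uniform convergence of `S_n`
on compact subsets of `(-1, 1)` to a continuous positive limit `S∞`; and then identify
`lim S_n = (2/π) √(1-x²) / α'(x)` (D–N Thm 1, (12); Máté–Nevai), which gives the continuous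
positive density.

We follow exactly this architecture, with the normalisation
`S_n := a_{n+2} p_{n+1}² - (x - b_{n+1}) p_{n+1} p_n + a_{n+1} p_n²`
`= a_{n+2} (p_{n+1}² - p_{n+2} p_n)`
(D–N's `S_{n+1} / a_{n+2}`; indices shifted by one to avoid `p_{-1}`):

1. `MateNevai.recurrence` — the three-term recurrence
   `x p_n = a_{n+1} p_{n+1} + b_n p_n + a_n p_{n-1}` with `a_n = k_{n-1}/k_n`,
   `b_n = ∫ x p_n²` (Van Assche, Lemma 0.3), from orthonormality via
   `Polynomial.Sequence.span_degreeLT`.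
2. `MateNevai.exists_ae_abs_le` — `τ` is carried by a compact interval `[-R, R]`: bounded
   recurrence coefficients give the moment growth `∫ (x^m p_n)² dτ ≤ K^m`
   (`MateNevai.exists_moment_bound`, the elementary form of `‖J‖ < ∞` for the Jacobi matrix),
   and Markov's inequality.
3. `MateNevai.tendsto_integral_continuous_mul` — Nevai's weak convergence for the class `M(0,1)`
   (P. Nevai, *Orthogonal Polynomials*, Mem. AMS 213 (1979), §4.1):
   `∫ f p_n p_{n+k} dτ → π⁻¹ ∫₀^π f(cos θ) cos(kθ) dθ` for continuous `f`; for `f = x^j` by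
   induction on `j` through the recurrence (`MateNevai.tendsto_moment` — the Chebyshev side obeys
   the same recursion by `2 cos θ cos kθ = cos(k+1)θ + cos(k-1)θ`, so no closed form of the
   Chebyshev moments is needed), then polynomials, then continuous `f` by Weierstrass
   approximation on `[-R, R]` (`exists_polynomial_near_of_continuousOn`).
4. `MateNevai.S_lower`, `MateNevai.abs_S_succ_sub_le`, `MateNevai.S_bounds`, `MateNevai.S_limit`
   — D–N (5), (6), (10): positivity, the variation estimate
   `|S_{n+1} - S_n| ≤ (ε_n / c)(S_{n+1} + S_n)`, a discrete Grönwall lemma on `log S_n`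
   (`MateNevai.abs_log_sub_log_le_tsum`), uniform bounds `0 < m ≤ S_n ≤ M` on `[-r, r]`,
   summable sup-variation, hence locally uniform convergence to a continuous positive `S∞`
   (`cauchySeq_of_dist_le_of_summable`, `TendstoUniformlyOn.continuousOn`).
5. Identification (D–N Thm 1 (12)): for `f` continuous supported in `[-r, r] ⊂ (-1, 1)`,
   `∫ f S_n dτ → ∫ f S∞ dτ` (uniform convergence) and, by step 3 with `k = 0, 2` and
   `½ (1 - cos 2θ) = sin² θ`, `∫ f S_n dτ → π⁻¹ ∫₀^π f(cos θ) sin² θ dθ = π⁻¹ ∫_{-1}^1 f √(1-x²) dx`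
   (`MateNevai.integral_mul_Sinf`); dividing the test function by `S∞` gives
   `∫ f dτ = ∫_{-1}^1 f g dx`, `g = √(1-x²) / (π S∞)`
   (`MateNevai.integral_eq_integral_mul_density`).
6. From test functions to measures (`MateNevai.restrict_Ioo_eq_withDensity`): monotone
   convergence along continuous bumps `φ_m ↑ 1_{(α,β)}` for `[α, β] ⊂ (-1, 1)`, continuity from
   below for intervals touching `±1`, and `Real.measure_ext_Ioo_rat`.

Deviations from the printed proofs: the compact support of `τ` is derived from a crude
`(u+v+w)² ≤ 3(u²+v²+w²)` moment bound instead of operator theory; the weak limit is identified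
through the trigonometric recursion instead of Nevai's closed-form Chebyshev moments; the
a.e.-identification `lim S_n = (2/π)√(1-x²)/α'` of D–N (12) is replaced by the equivalent
statement `S∞ dτ = π⁻¹ √(1-x²) dx` on `(-1, 1)` against test functions, which yields the density
directly. Deliberately NOT here: D–N Theorems 2–3 (Szegő class, `Σ n(…) < ∞`), mass points
outside `[-1, 1]`, the Máté–Nevai–Totik asymptotics (Van Assche Thm 2.28).

All auxiliary results live in the sub-namespace `Literature.Analysis.Approximation.MateNevai`
and take the orthonormality data as explicit hypotheses (`hmom`, `hdeg`, `hlc`, `horth`) and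
the abbreviations `A n = k_n / k_{n+1}` (`= a_{n+1}`), `B n = ∫ x p_n² dτ` (`= b_n`),
`S n x` (the Turán form above) as hypotheses-with-definitions (`hA`, `hB`, `hS`), so that the
file introduces no new definitions.
-/

noncomputable section

open MeasureTheory Set Filter Polynomial
open scoped Topology ENNReal Polynomial Real

namespace Literature.Analysis.Approximation

namespace MateNevai

variable {τ : Measure ℝ} {p : ℕ → ℝ[X]}

/-! ### Integrability of polynomials against a measure with finite moments -/

/-- A measure all of whose moments are finite is finite. [folklore] -/
theorem isFiniteMeasure_of_moments (hmom : ∀ k : ℕ, Integrable (fun ω : ℝ => ω ^ k) τ) :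
    IsFiniteMeasure τ := by
  have h := hmom 0
  simp only [pow_zero] at h
  exact (integrable_const_iff.1 h).resolve_left one_ne_zero

/-- Every polynomial is integrable against a measure with finite moments. [folklore] -/
theorem integrable_eval (hmom : ∀ k : ℕ, Integrable (fun ω : ℝ => ω ^ k) τ) (f : ℝ[X]) :
    Integrable (fun ω => f.eval ω) τ := by
  have : (fun ω => f.eval ω) =
      fun ω => ∑ i ∈ Finset.range (f.natDegree + 1), f.coeff i * ω ^ i := by
    funext ω; rw [eval_eq_sum_range]
  rw [this]
  exact integrable_finsetSum _ fun i _ => (hmom i).const_mul _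

/-- Products of polynomials are integrable against a measure with finite moments. [folklore] -/
theorem integrable_eval_mul (hmom : ∀ k : ℕ, Integrable (fun ω : ℝ => ω ^ k) τ) (f g : ℝ[X]) :
    Integrable (fun ω => f.eval ω * g.eval ω) τ := by
  simpa only [eval_mul] using integrable_eval hmom (f * g)

/-! ### Orthogonality against lower-degree polynomials -/

/-- `∫ p_m · (Σ lᵢ pᵢ) dτ = l_m` for an orthonormal sequence. [folklore] -/
theorem integral_mul_linearCombination (hmom : ∀ k : ℕ, Integrable (fun ω : ℝ => ω ^ k) τ)
    (horth : ∀ m n, ∫ ω, (p m).eval ω * (p n).eval ω ∂τ = if m = n then 1 else 0)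
    (m : ℕ) (l : ℕ →₀ ℝ) :
    ∫ ω, (p m).eval ω * (Finsupp.linearCombination ℝ p l).eval ω ∂τ = l m := by
  rw [Finsupp.linearCombination_apply, Finsupp.sum]
  have e : ∀ ω, (p m).eval ω * (∑ i ∈ l.support, l i • p i).eval ω =
      ∑ i ∈ l.support, l i * ((p m).eval ω * (p i).eval ω) := fun ω => by
    rw [eval_finsetSum, Finset.mul_sum]
    exact Finset.sum_congr rfl fun i _ => by rw [eval_smul, smul_eq_mul]; ring
  simp_rw [e]
  rw [integral_finsetSum _ (fun i _ => (integrable_eval_mul hmom (p m) (p i)).const_mul (l i))]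
  simp_rw [integral_const_mul, horth, mul_ite, mul_one, mul_zero, Finset.sum_ite_eq]
  by_cases hms : m ∈ l.support
  · rw [if_pos hms]
  · rw [if_neg hms]; exact (Finsupp.notMem_support_iff.1 hms).symm

/-- A polynomial of degree `< n` lies in the span of `p_0, …, p_{n-1}`. [folklore] -/
theorem exists_linearCombination_of_degree_lt (hdeg : ∀ n, (p n).natDegree = n)
    (hlc : ∀ n, 0 < (p n).leadingCoeff) {n : ℕ} {q : ℝ[X]} (hq : q.degree < n) :
    ∃ l : ℕ →₀ ℝ, l ∈ Finsupp.supported ℝ ℝ (Set.Iio n) ∧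
      Finsupp.linearCombination ℝ p l = q := by
  have hpdeg' : ∀ n, (p n).degree = n := fun n => by
    rw [degree_eq_natDegree (leadingCoeff_ne_zero.1 (hlc n).ne'), hdeg n]
  have hspan : Submodule.span ℝ (p '' Set.Iio n) = degreeLT ℝ n :=
    (⟨p, hpdeg'⟩ : Polynomial.Sequence ℝ).span_degreeLT fun i _ => (hlc i).ne'.isUnit
  exact (Finsupp.mem_span_image_iff_linearCombination ℝ).1
    (show q ∈ Submodule.span ℝ (p '' Set.Iio n) by rw [hspan]; exact mem_degreeLT.2 hq)

/-- `p_n` is orthogonal to every polynomial of degree `< n`. [folklore] -/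
theorem integral_mul_eq_zero_of_degree_lt (hmom : ∀ k : ℕ, Integrable (fun ω : ℝ => ω ^ k) τ)
    (hdeg : ∀ n, (p n).natDegree = n) (hlc : ∀ n, 0 < (p n).leadingCoeff)
    (horth : ∀ m n, ∫ ω, (p m).eval ω * (p n).eval ω ∂τ = if m = n then 1 else 0)
    {n : ℕ} {q : ℝ[X]} (hq : q.degree < n) :
    ∫ ω, (p n).eval ω * q.eval ω ∂τ = 0 := by
  obtain ⟨l, hl, rfl⟩ := exists_linearCombination_of_degree_lt hdeg hlc hq
  rw [integral_mul_linearCombination hmom horth]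
  exact Finsupp.notMem_support_iff.1 fun h =>
    lt_irrefl n ((Finsupp.mem_supported _ _).1 hl h)

/-- A polynomial of degree `< n` orthogonal to `p_0, …, p_{n-1}` vanishes. [folklore] -/
theorem eq_zero_of_degree_lt_of_orthogonal (hmom : ∀ k : ℕ, Integrable (fun ω : ℝ => ω ^ k) τ)
    (hdeg : ∀ n, (p n).natDegree = n) (hlc : ∀ n, 0 < (p n).leadingCoeff)
    (horth : ∀ m n, ∫ ω, (p m).eval ω * (p n).eval ω ∂τ = if m = n then 1 else 0)
    {n : ℕ} {r : ℝ[X]} (hr : r.degree < n)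
    (hr0 : ∀ m < n, ∫ ω, (p m).eval ω * r.eval ω ∂τ = 0) : r = 0 := by
  obtain ⟨l, hl, rfl⟩ := exists_linearCombination_of_degree_lt hdeg hlc hr
  suffices hcoef : ∀ m, l m = 0 by rw [(Finsupp.ext hcoef : l = 0), map_zero]
  intro m
  by_cases hm : m < n
  · have h0 := hr0 m hm
    rwa [integral_mul_linearCombination hmom horth] at h0
  · exact Finsupp.notMem_support_iff.1 fun h => hm ((Finsupp.mem_supported _ _).1 hl h)

/-- `∫ p_n q dτ = lc(q) / k_n` for `deg q = n`. [folklore] -/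
theorem integral_mul_eq_of_degree_eq (hmom : ∀ k : ℕ, Integrable (fun ω : ℝ => ω ^ k) τ)
    (hdeg : ∀ n, (p n).natDegree = n) (hlc : ∀ n, 0 < (p n).leadingCoeff)
    (horth : ∀ m n, ∫ ω, (p m).eval ω * (p n).eval ω ∂τ = if m = n then 1 else 0)
    {n : ℕ} {q : ℝ[X]} (hq : q.degree = n) :
    ∫ ω, (p n).eval ω * q.eval ω ∂τ = q.leadingCoeff / (p n).leadingCoeff := by
  have hpdeg' : (p n).degree = n := by
    rw [degree_eq_natDegree (leadingCoeff_ne_zero.1 (hlc n).ne'), hdeg n]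
  set c := q.leadingCoeff / (p n).leadingCoeff with hc
  have hq0 : q ≠ 0 := fun h => by rw [h, degree_zero] at hq; exact WithBot.bot_ne_coe hq
  have hlcq : q.leadingCoeff ≠ 0 := leadingCoeff_ne_zero.2 hq0
  have hc0 : c ≠ 0 := div_ne_zero hlcq (hlc n).ne'
  have h1 : (C c * p n).degree = n := by rw [degree_C_mul hc0, hpdeg']
  have hlc' : q.leadingCoeff = (C c * p n).leadingCoeff := by
    rw [leadingCoeff_mul, leadingCoeff_C, hc, div_mul_cancel₀ _ (hlc n).ne']
  have hr : (q - C c * p n).degree < n := hq ▸ degree_sub_lt (hq.trans h1.symm) hq0 hlc'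
  have h0 := integral_mul_eq_zero_of_degree_lt hmom hdeg hlc horth hr
  have e : ∀ ω, (p n).eval ω * (q - C c * p n).eval ω =
      (p n).eval ω * q.eval ω - c * ((p n).eval ω * (p n).eval ω) := fun ω => by
    simp only [eval_sub, eval_mul, eval_C]; ring
  simp_rw [e] at h0
  rw [integral_sub (integrable_eval_mul hmom _ _) ((integrable_eval_mul hmom _ _).const_mul c),
    integral_const_mul, horth, if_pos rfl, mul_one, sub_eq_zero] at h0
  exact h0

/-! ### The three-term recurrence relation -/

/-- **Three-term recurrence** (Van Assche, LNM 1265, Lemma 0.3, (0.2.4)–(0.2.5); Szegő §3.2):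
`x p_{n+1} = a_{n+2} p_{n+2} + b_{n+1} p_{n+1} + a_{n+1} p_n` with `a_{n+1} = k_n / k_{n+1}`,
`b_n = ∫ x p_n² dτ`. [cite: VanAssche1987, Lemma 0.3] -/
theorem recurrence (hmom : ∀ k : ℕ, Integrable (fun ω : ℝ => ω ^ k) τ)
    (hdeg : ∀ n, (p n).natDegree = n) (hlc : ∀ n, 0 < (p n).leadingCoeff)
    (horth : ∀ m n, ∫ ω, (p m).eval ω * (p n).eval ω ∂τ = if m = n then 1 else 0) (n : ℕ) :
    X * p (n + 1) = C ((p (n + 1)).leadingCoeff / (p (n + 2)).leadingCoeff) * p (n + 2) +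
      C (∫ ω, ω * ((p (n + 1)).eval ω) ^ 2 ∂τ) * p (n + 1) +
      C ((p n).leadingCoeff / (p (n + 1)).leadingCoeff) * p n := by
  have hpdeg' : ∀ n, (p n).degree = n := fun n => by
    rw [degree_eq_natDegree (leadingCoeff_ne_zero.1 (hlc n).ne'), hdeg n]
  have hp0 : ∀ n, p n ≠ 0 := fun n => leadingCoeff_ne_zero.1 (hlc n).ne'
  set a₂ := (p (n + 1)).leadingCoeff / (p (n + 2)).leadingCoeff with ha₂
  set b₁ := ∫ ω, ω * ((p (n + 1)).eval ω) ^ 2 ∂τ with hb₁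
  set a₁ := (p n).leadingCoeff / (p (n + 1)).leadingCoeff with ha₁
  rw [← sub_eq_zero]
  refine eq_zero_of_degree_lt_of_orthogonal hmom hdeg hlc horth (n := n + 3) ?_ ?_
  · -- degree bound
    have h1 : (X * p (n + 1)).natDegree ≤ n + 2 := by
      rw [natDegree_X_mul (hp0 _), hdeg]
    have h2 : (C a₂ * p (n + 2)).natDegree ≤ n + 2 :=
      (natDegree_C_mul_le _ _).trans (hdeg _).le
    have h3 : (C b₁ * p (n + 1)).natDegree ≤ n + 2 :=
      (natDegree_C_mul_le _ _).trans ((hdeg _).le.trans (by omega))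
    have h4 : (C a₁ * p n).natDegree ≤ n + 2 :=
      (natDegree_C_mul_le _ _).trans ((hdeg _).le.trans (by omega))
    have h : (X * p (n + 1) - (C a₂ * p (n + 2) + C b₁ * p (n + 1) + C a₁ * p n)).natDegree ≤
        n + 2 :=
      (natDegree_sub_le _ _).trans (max_le h1 ((natDegree_add_le _ _).trans
        (max_le ((natDegree_add_le _ _).trans (max_le h2 h3)) h4)))
    exact (degree_le_of_natDegree_le h).trans_lt (by exact_mod_cast (by omega : n + 2 < n + 3))
  · intro m hm
    -- the four inner products `∫ p_m (x p_{n+1})`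
    have hX : ∀ m, ∫ ω, (p m).eval ω * (X * p (n + 1)).eval ω ∂τ =
        ∫ ω, (p (n + 1)).eval ω * (X * p m).eval ω ∂τ := fun m =>
      integral_congr_ae (Eventually.of_forall fun ω => by simp only [eval_mul, eval_X]; ring)
    have e : ∀ ω, (p m).eval ω * (X * p (n + 1) - (C a₂ * p (n + 2) + C b₁ * p (n + 1) +
        C a₁ * p n)).eval ω = (p m).eval ω * (X * p (n + 1)).eval ω -
        (a₂ * ((p m).eval ω * (p (n + 2)).eval ω) + b₁ * ((p m).eval ω * (p (n + 1)).eval ω) +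
          a₁ * ((p m).eval ω * (p n).eval ω)) := fun ω => by
      simp only [eval_sub, eval_add, eval_mul, eval_C]; ring
    simp_rw [e]
    have i1 : Integrable (fun ω => a₂ * ((p m).eval ω * (p (n + 2)).eval ω)) τ :=
      (integrable_eval_mul hmom _ _).const_mul a₂
    have i2 : Integrable (fun ω => b₁ * ((p m).eval ω * (p (n + 1)).eval ω)) τ :=
      (integrable_eval_mul hmom _ _).const_mul b₁
    have i3 : Integrable (fun ω => a₁ * ((p m).eval ω * (p n).eval ω)) τ :=
      (integrable_eval_mul hmom _ _).const_mul a₁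
    have i12 : Integrable (fun ω => a₂ * ((p m).eval ω * (p (n + 2)).eval ω) +
        b₁ * ((p m).eval ω * (p (n + 1)).eval ω)) τ := i1.add i2
    have i123 : Integrable (fun ω => a₂ * ((p m).eval ω * (p (n + 2)).eval ω) +
        b₁ * ((p m).eval ω * (p (n + 1)).eval ω) + a₁ * ((p m).eval ω * (p n).eval ω)) τ :=
      i12.add i3
    rw [integral_sub (integrable_eval_mul hmom _ _) i123, integral_add i12 i3, integral_add i1 i2,
      integral_const_mul, integral_const_mul, integral_const_mul, horth, horth, horth]
    rcases (by omega : m < n ∨ m = n ∨ m = n + 1 ∨ m = n + 2) with h | h | h | h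
    · -- `m < n`: everything vanishes
      rw [if_neg (by omega), if_neg (by omega), if_neg (by omega), hX,
        integral_mul_eq_zero_of_degree_lt hmom hdeg hlc horth]
      · ring
      · rw [degree_mul, degree_X, hpdeg']; exact_mod_cast (by omega : 1 + m < n + 1)
    · subst h
      rw [if_neg (by omega), if_neg (by omega), if_pos rfl, hX,
        integral_mul_eq_of_degree_eq hmom hdeg hlc horth]
      · rw [mul_comm X, leadingCoeff_mul_X, ha₁]; ring
      · rw [degree_mul, degree_X, hpdeg']; exact_mod_cast (by omega : 1 + m = m + 1)
    · subst h
      rw [if_neg (by omega), if_pos rfl, if_neg (by omega)]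
      have : ∫ ω, (p (n + 1)).eval ω * (X * p (n + 1)).eval ω ∂τ = b₁ := by
        rw [hb₁]; exact integral_congr_ae (Eventually.of_forall fun ω => by
          simp only [eval_mul, eval_X]; ring)
      rw [this]; ring
    · subst h
      rw [if_pos rfl, if_neg (by omega), if_neg (by omega),
        integral_mul_eq_of_degree_eq hmom hdeg hlc horth]
      · rw [mul_comm X, leadingCoeff_mul_X, ha₂]; ring
      · rw [degree_mul, degree_X, hpdeg']; exact_mod_cast (by omega : 1 + (n + 1) = n + 2)

/-- The recurrence at `n = 0`: `x p_0 = a_1 p_1 + b_0 p_0`. [cite: VanAssche1987, Lemma 0.3] -/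
theorem recurrence_zero (hmom : ∀ k : ℕ, Integrable (fun ω : ℝ => ω ^ k) τ)
    (hdeg : ∀ n, (p n).natDegree = n) (hlc : ∀ n, 0 < (p n).leadingCoeff)
    (horth : ∀ m n, ∫ ω, (p m).eval ω * (p n).eval ω ∂τ = if m = n then 1 else 0) :
    X * p 0 = C ((p 0).leadingCoeff / (p 1).leadingCoeff) * p 1 +
      C (∫ ω, ω * ((p 0).eval ω) ^ 2 ∂τ) * p 0 := by
  have hpdeg' : ∀ n, (p n).degree = n := fun n => by
    rw [degree_eq_natDegree (leadingCoeff_ne_zero.1 (hlc n).ne'), hdeg n]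
  have hp0 : ∀ n, p n ≠ 0 := fun n => leadingCoeff_ne_zero.1 (hlc n).ne'
  set a₁ := (p 0).leadingCoeff / (p 1).leadingCoeff with ha₁
  set b₀ := ∫ ω, ω * ((p 0).eval ω) ^ 2 ∂τ with hb₀
  rw [← sub_eq_zero]
  refine eq_zero_of_degree_lt_of_orthogonal hmom hdeg hlc horth (n := 2) ?_ ?_
  · have h1 : (X * p 0).natDegree ≤ 1 := by rw [natDegree_X_mul (hp0 _), hdeg]
    have h2 : (C a₁ * p 1).natDegree ≤ 1 := (natDegree_C_mul_le _ _).trans (hdeg _).le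
    have h3 : (C b₀ * p 0).natDegree ≤ 1 :=
      (natDegree_C_mul_le _ _).trans ((hdeg _).le.trans (by omega))
    have h : (X * p 0 - (C a₁ * p 1 + C b₀ * p 0)).natDegree ≤ 1 :=
      (natDegree_sub_le _ _).trans (max_le h1 ((natDegree_add_le _ _).trans (max_le h2 h3)))
    exact (degree_le_of_natDegree_le h).trans_lt (by exact_mod_cast (by omega : 1 < 2))
  · intro m hm
    have e : ∀ ω, (p m).eval ω * (X * p 0 - (C a₁ * p 1 + C b₀ * p 0)).eval ω =
        (p m).eval ω * (X * p 0).eval ω -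
        (a₁ * ((p m).eval ω * (p 1).eval ω) + b₀ * ((p m).eval ω * (p 0).eval ω)) := fun ω => by
      simp only [eval_sub, eval_add, eval_mul, eval_C]; ring
    simp_rw [e]
    have i1 : Integrable (fun ω => a₁ * ((p m).eval ω * (p 1).eval ω)) τ :=
      (integrable_eval_mul hmom _ _).const_mul a₁
    have i2 : Integrable (fun ω => b₀ * ((p m).eval ω * (p 0).eval ω)) τ :=
      (integrable_eval_mul hmom _ _).const_mul b₀
    have i12 : Integrable (fun ω => a₁ * ((p m).eval ω * (p 1).eval ω) +
        b₀ * ((p m).eval ω * (p 0).eval ω)) τ := i1.add i2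
    rw [integral_sub (integrable_eval_mul hmom _ _) i12, integral_add i1 i2, integral_const_mul,
      integral_const_mul, horth, horth]
    rcases (by omega : m = 0 ∨ m = 1) with h | h
    · subst h
      rw [if_neg (by omega), if_pos rfl]
      have : ∫ ω, (p 0).eval ω * (X * p 0).eval ω ∂τ = b₀ := by
        rw [hb₀]; exact integral_congr_ae (Eventually.of_forall fun ω => by
          simp only [eval_mul, eval_X]; ring)
      rw [this]; ring
    · subst h
      rw [if_pos rfl, if_neg (by omega), integral_mul_eq_of_degree_eq hmom hdeg hlc horth]
      · rw [mul_comm X, leadingCoeff_mul_X, ha₁]; ring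
      · rw [degree_mul, degree_X, hpdeg']; norm_num


/-! ### Bounded sequences -/

/-- A convergent real sequence is bounded in absolute value. [folklore] -/
theorem exists_abs_le_of_tendsto {u : ℕ → ℝ} {a : ℝ} (h : Tendsto u atTop (𝓝 a)) :
    ∃ M : ℝ, 0 ≤ M ∧ ∀ n, |u n| ≤ M := by
  obtain ⟨M, hM⟩ := h.abs.bddAbove_range
  exact ⟨max M 0, le_max_right _ _, fun n => (hM ⟨n, rfl⟩).trans (le_max_left _ _)⟩

/-! ### Moment growth and compact support -/

section Support

variable (hmom : ∀ k : ℕ, Integrable (fun ω : ℝ => ω ^ k) τ)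
  (hdeg : ∀ n, (p n).natDegree = n) (hlc : ∀ n, 0 < (p n).leadingCoeff)
  (horth : ∀ m n, ∫ ω, (p m).eval ω * (p n).eval ω ∂τ = if m = n then 1 else 0)
include hmom hdeg hlc horth

omit hdeg hlc horth in
/-- One step of the moment-growth induction: `∫ (c₁g₁ + c₂g₂ + c₃g₃)² ≤ 3 Σ cᵢ² ∫ gᵢ²`.
[folklore] -/
theorem integral_sq_three_le {g₁ g₂ g₃ : ℝ[X]} {c₁ c₂ c₃ M₁ M₂ M₃ : ℝ}
    (h₁ : ∫ ω, (g₁.eval ω) ^ 2 ∂τ ≤ M₁) (h₂ : ∫ ω, (g₂.eval ω) ^ 2 ∂τ ≤ M₂)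
    (h₃ : ∫ ω, (g₃.eval ω) ^ 2 ∂τ ≤ M₃) :
    ∫ ω, ((C c₁ * g₁ + C c₂ * g₂ + C c₃ * g₃).eval ω) ^ 2 ∂τ ≤
      3 * (c₁ ^ 2 * M₁ + c₂ ^ 2 * M₂ + c₃ ^ 2 * M₃) := by
  have hint2 : ∀ f : ℝ[X], Integrable (fun ω => (f.eval ω) ^ 2) τ := fun f => by
    simpa only [sq] using integrable_eval_mul hmom f f
  have hle : ∀ ω, ((C c₁ * g₁ + C c₂ * g₂ + C c₃ * g₃).eval ω) ^ 2 ≤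
      3 * (c₁ ^ 2 * (g₁.eval ω) ^ 2 + c₂ ^ 2 * (g₂.eval ω) ^ 2 + c₃ ^ 2 * (g₃.eval ω) ^ 2) :=
    fun ω => by
      simp only [eval_add, eval_mul, eval_C]
      nlinarith [sq_nonneg (c₁ * g₁.eval ω - c₂ * g₂.eval ω),
        sq_nonneg (c₂ * g₂.eval ω - c₃ * g₃.eval ω), sq_nonneg (c₁ * g₁.eval ω - c₃ * g₃.eval ω)]
  have i1 : Integrable (fun ω => c₁ ^ 2 * (g₁.eval ω) ^ 2) τ := (hint2 g₁).const_mul _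
  have i2 : Integrable (fun ω => c₂ ^ 2 * (g₂.eval ω) ^ 2) τ := (hint2 g₂).const_mul _
  have i3 : Integrable (fun ω => c₃ ^ 2 * (g₃.eval ω) ^ 2) τ := (hint2 g₃).const_mul _
  have i12 : Integrable (fun ω => c₁ ^ 2 * (g₁.eval ω) ^ 2 + c₂ ^ 2 * (g₂.eval ω) ^ 2) τ :=
    i1.add i2
  have i123 : Integrable (fun ω => c₁ ^ 2 * (g₁.eval ω) ^ 2 + c₂ ^ 2 * (g₂.eval ω) ^ 2 +
      c₃ ^ 2 * (g₃.eval ω) ^ 2) τ := i12.add i3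
  have i123' : Integrable (fun ω => 3 * (c₁ ^ 2 * (g₁.eval ω) ^ 2 + c₂ ^ 2 * (g₂.eval ω) ^ 2 +
      c₃ ^ 2 * (g₃.eval ω) ^ 2)) τ := i123.const_mul 3
  calc ∫ ω, ((C c₁ * g₁ + C c₂ * g₂ + C c₃ * g₃).eval ω) ^ 2 ∂τ
      ≤ ∫ ω, 3 * (c₁ ^ 2 * (g₁.eval ω) ^ 2 + c₂ ^ 2 * (g₂.eval ω) ^ 2 +
          c₃ ^ 2 * (g₃.eval ω) ^ 2) ∂τ := integral_mono (hint2 _) i123' hle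
    _ = 3 * (c₁ ^ 2 * ∫ ω, (g₁.eval ω) ^ 2 ∂τ + c₂ ^ 2 * ∫ ω, (g₂.eval ω) ^ 2 ∂τ +
          c₃ ^ 2 * ∫ ω, (g₃.eval ω) ^ 2 ∂τ) := by
        rw [integral_const_mul, integral_add i12 i3, integral_add i1 i2, integral_const_mul,
          integral_const_mul, integral_const_mul]
    _ ≤ 3 * (c₁ ^ 2 * M₁ + c₂ ^ 2 * M₂ + c₃ ^ 2 * M₃) := by gcongr

/-- **Exponential moment growth**: if the recurrence coefficients are bounded, then
`∫ (x^m p_n(x))² dτ ≤ K^m` for a constant `K ≥ 1` (a crude form of `‖J‖ ≤ 2 sup aₙ + sup |bₙ|`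
for the Jacobi matrix). [folklore] -/
theorem exists_moment_bound {Ab Bb : ℝ}
    (hAb : ∀ n, |(p n).leadingCoeff / (p (n + 1)).leadingCoeff| ≤ Ab)
    (hBb : ∀ n, |∫ ω, ω * ((p n).eval ω) ^ 2 ∂τ| ≤ Bb) :
    ∃ K : ℝ, 1 ≤ K ∧ ∀ m n : ℕ, ∫ ω, ((X ^ m * p n).eval ω) ^ 2 ∂τ ≤ K ^ m := by
  set K := 3 * (2 * Ab ^ 2 + Bb ^ 2) + 1 with hK
  have hK1 : 1 ≤ K := by nlinarith [sq_nonneg Ab, sq_nonneg Bb]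
  refine ⟨K, hK1, ?_⟩
  have hsq0 : ∀ n, ∫ ω, ((p n).eval ω) ^ 2 ∂τ = 1 := fun n => by
    simpa only [sq] using (horth n n).trans (if_pos rfl)
  have hA2 : ∀ j, ((p j).leadingCoeff / (p (j + 1)).leadingCoeff) ^ 2 ≤ Ab ^ 2 := fun j =>
    (sq_abs _).symm.trans_le (pow_le_pow_left₀ (abs_nonneg _) (hAb j) 2)
  have hB2 : ∀ j, (∫ ω, ω * ((p j).eval ω) ^ 2 ∂τ) ^ 2 ≤ Bb ^ 2 := fun j =>
    (sq_abs _).symm.trans_le (pow_le_pow_left₀ (abs_nonneg _) (hBb j) 2)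
  intro m
  induction m with
  | zero => intro n; simp only [pow_zero, one_mul, hsq0, le_refl]
  | succ m ih =>
    intro n
    have hKm : 0 ≤ K ^ m := pow_nonneg (by linarith) m
    have h0 : ∫ ω, ((0 : ℝ[X]).eval ω) ^ 2 ∂τ ≤ 0 := by simp
    rcases n with _ | n
    · -- `n = 0`: `x^{m+1} p_0 = x^m (a_1 p_1 + b_0 p_0)`
      have hf : X ^ (m + 1) * p 0 = C ((p 0).leadingCoeff / (p 1).leadingCoeff) * (X ^ m * p 1) +
          C (∫ ω, ω * ((p 0).eval ω) ^ 2 ∂τ) * (X ^ m * p 0) + C 0 * 0 := by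
        rw [pow_succ, mul_assoc, recurrence_zero hmom hdeg hlc horth]
        simp only [map_zero, zero_mul, add_zero]; ring
      rw [hf]
      refine (integral_sq_three_le hmom (ih 1) (ih 0) h0).trans ?_
      have e1 := mul_le_mul_of_nonneg_right (hA2 0) hKm
      have e2 := mul_le_mul_of_nonneg_right (hB2 0) hKm
      have h := mul_le_mul_of_nonneg_left (le_of_eq hK.symm : 3 * (2 * Ab ^ 2 + Bb ^ 2) + 1 ≤ K)
        hKm
      have hK' : 3 * (Ab ^ 2 * K ^ m + Bb ^ 2 * K ^ m) ≤ K ^ (m + 1) := by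
        rw [pow_succ K m]
        nlinarith [h, hKm, mul_nonneg hKm (sq_nonneg Ab), mul_nonneg hKm (sq_nonneg Bb)]
      have h00 : (0 : ℝ) ^ 2 * 0 = 0 := by norm_num
      linarith [e1, e2, hK', h00]
    · -- `n + 1`: `x^{m+1} p_{n+1} = x^m (a p_{n+2} + b p_{n+1} + a' p_n)`
      have hf : X ^ (m + 1) * p (n + 1) =
          C ((p (n + 1)).leadingCoeff / (p (n + 2)).leadingCoeff) * (X ^ m * p (n + 2)) +
          C (∫ ω, ω * ((p (n + 1)).eval ω) ^ 2 ∂τ) * (X ^ m * p (n + 1)) +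
          C ((p n).leadingCoeff / (p (n + 1)).leadingCoeff) * (X ^ m * p n) := by
        rw [pow_succ, mul_assoc, recurrence hmom hdeg hlc horth n]; ring
      rw [hf]
      refine (integral_sq_three_le hmom (ih (n + 2)) (ih (n + 1)) (ih n)).trans ?_
      have e1 := mul_le_mul_of_nonneg_right (hA2 (n + 1)) hKm
      have e2 := mul_le_mul_of_nonneg_right (hB2 (n + 1)) hKm
      have e3 := mul_le_mul_of_nonneg_right (hA2 n) hKm
      have h := mul_le_mul_of_nonneg_left (le_of_eq hK.symm : 3 * (2 * Ab ^ 2 + Bb ^ 2) + 1 ≤ K)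
        hKm
      have hK' : 3 * (Ab ^ 2 * K ^ m + Bb ^ 2 * K ^ m + Ab ^ 2 * K ^ m) ≤ K ^ (m + 1) := by
        rw [pow_succ K m]
        nlinarith [h, hKm, mul_nonneg hKm (sq_nonneg Ab), mul_nonneg hKm (sq_nonneg Bb)]
      linarith [e1, e2, e3, hK']

/-- **Compact support**: an orthogonality measure whose recurrence coefficients are bounded is
carried by a compact interval `[-R, R]` (the spectrum of the bounded Jacobi matrix; here from the
moment growth `∫ x^{2m} dτ ≤ c K^m` and Markov's inequality). [folklore] -/
theorem exists_ae_abs_le {Ab Bb : ℝ}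
    (hAb : ∀ n, |(p n).leadingCoeff / (p (n + 1)).leadingCoeff| ≤ Ab)
    (hBb : ∀ n, |∫ ω, ω * ((p n).eval ω) ^ 2 ∂τ| ≤ Bb) :
    ∃ R : ℝ, 1 ≤ R ∧ ∀ᵐ ω ∂τ, |ω| ≤ R := by
  haveI := isFiniteMeasure_of_moments hmom
  obtain ⟨K, hK1, hK⟩ := exists_moment_bound hmom hdeg hlc horth hAb hBb
  refine ⟨K + 1, by linarith, ?_⟩
  -- `p 0` is the constant `c₀ > 0`
  set c₀ := (p 0).leadingCoeff with hc₀
  have hp0 : p 0 = C c₀ := by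
    conv_lhs => rw [eq_C_of_natDegree_eq_zero (hdeg 0)]
    rw [hc₀, ← coeff_natDegree, hdeg 0]
  have hc₀pos : 0 < c₀ := hlc 0
  -- moments: `∫ ω^{2m} dτ ≤ K^m / c₀²`
  have hmom2 : ∀ m : ℕ, ∫ ω, ω ^ (2 * m) ∂τ ≤ K ^ m / c₀ ^ 2 := fun m => by
    have e : ∀ ω : ℝ, ω ^ (2 * m) = c₀⁻¹ ^ 2 * ((X ^ m * p 0).eval ω) ^ 2 := fun ω => by
      rw [hp0]; simp only [eval_mul, eval_pow, eval_X, eval_C]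
      field_simp; ring
    simp_rw [e]
    rw [integral_const_mul, div_eq_inv_mul, ← inv_pow]
    exact mul_le_mul_of_nonneg_left (hK m 0) (sq_nonneg _)
  -- Markov: `τ {K + 1 < |ω|} ≤ (K / (K+1)²)^m / c₀²` for every `m`
  set s := {ω : ℝ | K + 1 < |ω|} with hs
  have hR0 : 0 < K + 1 := by linarith
  have hsub : ∀ m : ℕ, s ⊆ {ω : ℝ | (K + 1) ^ (2 * m) ≤ ω ^ (2 * m)} := fun m ω hω => by
    simp only [hs, mem_setOf_eq] at hω ⊢
    calc (K + 1) ^ (2 * m) ≤ |ω| ^ (2 * m) := pow_le_pow_left₀ hR0.le hω.le _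
      _ = ω ^ (2 * m) := by rw [pow_mul, pow_mul, sq_abs]
  have hreal : ∀ m : ℕ, τ.real s ≤ (K / (K + 1) ^ 2) ^ m / c₀ ^ 2 := fun m => by
    have hM := mul_meas_ge_le_integral_of_nonneg (μ := τ) (f := fun ω : ℝ => ω ^ (2 * m))
      (Eventually.of_forall fun ω => by simp only [Pi.zero_apply, pow_mul]; positivity)
      (hmom (2 * m)) ((K + 1) ^ (2 * m))
    have hpos : 0 < (K + 1) ^ (2 * m) := pow_pos hR0 _
    have h1 : τ.real s ≤ τ.real {ω : ℝ | (K + 1) ^ (2 * m) ≤ ω ^ (2 * m)} :=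
      measureReal_mono (hsub m)
    have h2 : τ.real {ω : ℝ | (K + 1) ^ (2 * m) ≤ ω ^ (2 * m)} ≤
        K ^ m / c₀ ^ 2 / (K + 1) ^ (2 * m) := by
      rw [le_div_iff₀ hpos, mul_comm]; exact hM.trans (hmom2 m)
    calc τ.real s ≤ K ^ m / c₀ ^ 2 / (K + 1) ^ (2 * m) := h1.trans h2
      _ = (K / (K + 1) ^ 2) ^ m / c₀ ^ 2 := by
          rw [div_pow, pow_mul, ← pow_mul, mul_comm 2 m, pow_mul]; ring
  -- the right-hand side tends to `0`
  have hq : K / (K + 1) ^ 2 < 1 := by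
    rw [div_lt_one (by positivity)]; nlinarith
  have hq0 : 0 ≤ K / (K + 1) ^ 2 := by positivity
  have hlim : Tendsto (fun m : ℕ => (K / (K + 1) ^ 2) ^ m / c₀ ^ 2) atTop (𝓝 0) := by
    simpa only [zero_div] using (tendsto_pow_atTop_nhds_zero_of_lt_one hq0 hq).div_const (c₀ ^ 2)
  have hzero : τ.real s = 0 :=
    le_antisymm (ge_of_tendsto' hlim hreal) measureReal_nonneg
  have hs0 : τ s = 0 := (measureReal_eq_zero_iff (measure_ne_top τ s)).1 hzero
  rw [ae_iff]
  convert hs0 using 2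
  ext ω; simp only [hs, mem_setOf_eq, not_le]

end Support


/-! ### Chebyshev-side trigonometric integrals -/

section Trig

open Real intervalIntegral

/-- `∫₀^π cos(kθ) dθ = π [k = 0]`. [folklore] -/
theorem integral_cos_nat_mul (k : ℕ) :
    ∫ θ in (0 : ℝ)..π, Real.cos (k * θ) = if k = 0 then π else 0 := by
  rcases k with _ | k
  · simp
  · rw [if_neg (Nat.succ_ne_zero k)]
    have hk : ((k + 1 : ℕ) : ℝ) ≠ 0 := by positivity
    rw [intervalIntegral.integral_comp_mul_left (fun θ => Real.cos θ) hk, integral_cos]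
    have h := Real.sin_nat_mul_pi (k + 1)
    push_cast at h
    simp [h]

/-- `2 cos x cos y = cos (y + x) + cos (y - x)`. [folklore] -/
theorem two_mul_cos_mul_cos (x y : ℝ) :
    2 * (Real.cos x * Real.cos y) = Real.cos (y + x) + Real.cos (y - x) := by
  rw [Real.cos_add, Real.cos_sub]; ring

/-- The Chebyshev moments `∫₀^π cos^j θ cos(kθ) dθ` obey the free-Jacobi recursion, `k = 0`:
`∫ cos^{j+1} θ · cos(0·θ) = ∫ cos^j θ cos(1·θ)`. [folklore] -/
theorem chebMoment_succ_zero (j : ℕ) :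
    ∫ θ in (0 : ℝ)..π, Real.cos θ ^ (j + 1) * Real.cos (((0 : ℕ) : ℝ) * θ) =
      ∫ θ in (0 : ℝ)..π, Real.cos θ ^ j * Real.cos (((1 : ℕ) : ℝ) * θ) := by
  refine intervalIntegral.integral_congr fun θ _ => ?_
  simp [pow_succ]

/-- The Chebyshev moments obey the free-Jacobi recursion, `k + 1`:
`∫ cos^{j+1} θ cos((k+1)θ) = ½ (∫ cos^j θ cos(kθ) + ∫ cos^j θ cos((k+2)θ))`. [folklore] -/
theorem chebMoment_succ_succ (j k : ℕ) :
    ∫ θ in (0 : ℝ)..π, Real.cos θ ^ (j + 1) * Real.cos (((k + 1 : ℕ) : ℝ) * θ) =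
      1 / 2 * ((∫ θ in (0 : ℝ)..π, Real.cos θ ^ j * Real.cos ((k : ℝ) * θ)) +
        ∫ θ in (0 : ℝ)..π, Real.cos θ ^ j * Real.cos (((k + 2 : ℕ) : ℝ) * θ)) := by
  have e : ∀ θ : ℝ, Real.cos θ ^ (j + 1) * Real.cos (((k + 1 : ℕ) : ℝ) * θ) =
      1 / 2 * (Real.cos θ ^ j * Real.cos ((k : ℝ) * θ) +
        Real.cos θ ^ j * Real.cos (((k + 2 : ℕ) : ℝ) * θ)) := fun θ => by
    have h := two_mul_cos_mul_cos θ (((k + 1 : ℕ) : ℝ) * θ)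
    have e1 : ((k + 1 : ℕ) : ℝ) * θ + θ = ((k + 2 : ℕ) : ℝ) * θ := by push_cast; ring
    have e2 : ((k + 1 : ℕ) : ℝ) * θ - θ = (k : ℝ) * θ := by push_cast; ring
    rw [e1, e2] at h
    rw [pow_succ]
    linear_combination (Real.cos θ ^ j / 2) * h
  simp_rw [e]
  rw [intervalIntegral.integral_const_mul, intervalIntegral.integral_add]
  · exact (by fun_prop : Continuous fun θ =>
      Real.cos θ ^ j * Real.cos ((k : ℝ) * θ)).intervalIntegrable _ _
  · exact (by fun_prop : Continuous fun θ =>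
      Real.cos θ ^ j * Real.cos (((k + 2 : ℕ) : ℝ) * θ)).intervalIntegrable _ _

end Trig

/-! ### Weak limits of `p_n p_{n+k} dτ` (Nevai) -/

/-- `ω^j p_n(ω) p_m(ω)` is integrable. [folklore] -/
theorem integrable_pow_mul_eval_mul (hmom : ∀ k : ℕ, Integrable (fun ω : ℝ => ω ^ k) τ)
    (j n m : ℕ) : Integrable (fun ω => ω ^ j * ((p n).eval ω * (p m).eval ω)) τ := by
  have h := integrable_eval hmom (X ^ j * (p n * p m))
  simpa only [eval_mul, eval_pow, eval_X] using h

/-- Symmetry of the moments `∫ ω^j p_n p_m dτ` in the two polynomial indices. [folklore] -/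
theorem moment_symm (j n m : ℕ) :
    ∫ ω, ω ^ j * ((p n).eval ω * (p m).eval ω) ∂τ =
      ∫ ω, ω ^ j * ((p m).eval ω * (p n).eval ω) ∂τ :=
  integral_congr_ae (Eventually.of_forall fun ω => by simp only [mul_comm])

section WeakLimit

variable (hmom : ∀ k : ℕ, Integrable (fun ω : ℝ => ω ^ k) τ)
  (hdeg : ∀ n, (p n).natDegree = n) (hlc : ∀ n, 0 < (p n).leadingCoeff)
  (horth : ∀ m n, ∫ ω, (p m).eval ω * (p n).eval ω ∂τ = if m = n then 1 else 0)
  {A B : ℕ → ℝ} (hA : ∀ n, A n = (p n).leadingCoeff / (p (n + 1)).leadingCoeff)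
  (hB : ∀ n, B n = ∫ ω, ω * ((p n).eval ω) ^ 2 ∂τ)
include hmom hdeg hlc horth hA hB

/-- The recurrence, evaluated:
`ω p_{n+1}(ω) = A_{n+1} p_{n+2}(ω) + B_{n+1} p_{n+1}(ω) + A_n p_n(ω)`.
[cite: VanAssche1987, Lemma 0.3] -/
theorem recurrence_eval (n : ℕ) (ω : ℝ) :
    ω * (p (n + 1)).eval ω =
      A (n + 1) * (p (n + 2)).eval ω + B (n + 1) * (p (n + 1)).eval ω + A n * (p n).eval ω := by
  have h := congrArg (fun q => q.eval ω) (recurrence hmom hdeg hlc horth n)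
  simp only [eval_mul, eval_X, eval_add, eval_C] at h
  rw [hA, hA, hB]; linarith

/-- The recurrence at `n = 0`, evaluated. [cite: VanAssche1987, Lemma 0.3] -/
theorem recurrence_eval_zero (ω : ℝ) :
    ω * (p 0).eval ω = A 0 * (p 1).eval ω + B 0 * (p 0).eval ω := by
  have h := congrArg (fun q => q.eval ω) (recurrence_zero hmom hdeg hlc horth)
  simp only [eval_mul, eval_X, eval_add, eval_C] at h
  rw [hA, hB]; linarith

/-- One step of the Jacobi-matrix recursion for the moments `∫ ω^j p_n p_m dτ`. [folklore] -/
theorem moment_succ (j n m : ℕ) :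
    ∫ ω, ω ^ (j + 1) * ((p n).eval ω * (p (m + 1)).eval ω) ∂τ =
      A (m + 1) * ∫ ω, ω ^ j * ((p n).eval ω * (p (m + 2)).eval ω) ∂τ +
      B (m + 1) * ∫ ω, ω ^ j * ((p n).eval ω * (p (m + 1)).eval ω) ∂τ +
      A m * ∫ ω, ω ^ j * ((p n).eval ω * (p m).eval ω) ∂τ := by
  have e : ∀ ω, ω ^ (j + 1) * ((p n).eval ω * (p (m + 1)).eval ω) =
      A (m + 1) * (ω ^ j * ((p n).eval ω * (p (m + 2)).eval ω)) +
      B (m + 1) * (ω ^ j * ((p n).eval ω * (p (m + 1)).eval ω)) +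
      A m * (ω ^ j * ((p n).eval ω * (p m).eval ω)) := fun ω => by
    have h := recurrence_eval hmom hdeg hlc horth hA hB m ω
    rw [pow_succ]
    linear_combination (ω ^ j * (p n).eval ω) * h
  simp_rw [e]
  have i1 : Integrable (fun ω => A (m + 1) * (ω ^ j * ((p n).eval ω * (p (m + 2)).eval ω))) τ :=
    (integrable_pow_mul_eval_mul hmom j n (m + 2)).const_mul _
  have i2 : Integrable (fun ω => B (m + 1) * (ω ^ j * ((p n).eval ω * (p (m + 1)).eval ω))) τ :=
    (integrable_pow_mul_eval_mul hmom j n (m + 1)).const_mul _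
  have i3 : Integrable (fun ω => A m * (ω ^ j * ((p n).eval ω * (p m).eval ω))) τ :=
    (integrable_pow_mul_eval_mul hmom j n m).const_mul _
  have i12 : Integrable (fun ω => A (m + 1) * (ω ^ j * ((p n).eval ω * (p (m + 2)).eval ω)) +
      B (m + 1) * (ω ^ j * ((p n).eval ω * (p (m + 1)).eval ω))) τ := i1.add i2
  rw [integral_add i12 i3, integral_add i1 i2, integral_const_mul, integral_const_mul,
    integral_const_mul]

/-- **Weak convergence of `x^j p_n p_{n+k} dτ`** (Nevai, *Orthogonal Polynomials*, Mem. AMS 213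
(1979), §4.1; the invariance principle: the limit only depends on `lim aₙ = 1/2`, `lim bₙ = 0`):
`∫ x^j p_{n+1} p_{n+1+k} dτ → π⁻¹ ∫₀^π cos^j θ cos(kθ) dθ`. Proved by induction on `j` through the
recurrence; the Chebyshev side obeys the same recursion (`chebMoment_succ_succ`). [folklore] -/
theorem tendsto_moment (hAlim : Tendsto A atTop (𝓝 (1 / 2))) (hBlim : Tendsto B atTop (𝓝 0))
    (j k : ℕ) :
    Tendsto (fun n => ∫ ω, ω ^ j * ((p (n + 1)).eval ω * (p (n + 1 + k)).eval ω) ∂τ) atTop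
      (𝓝 (π⁻¹ * ∫ θ in (0 : ℝ)..π, Real.cos θ ^ j * Real.cos ((k : ℝ) * θ))) := by
  induction j generalizing k with
  | zero =>
    have e : ∀ n, ∫ ω, ω ^ 0 * ((p (n + 1)).eval ω * (p (n + 1 + k)).eval ω) ∂τ =
        if k = 0 then 1 else 0 := fun n => by
      simp only [pow_zero, one_mul, horth]
      by_cases hk : k = 0
      · simp [hk]
      · rw [if_neg hk, if_neg (by omega)]
    have e' : π⁻¹ * ∫ θ in (0 : ℝ)..π, Real.cos θ ^ 0 * Real.cos ((k : ℝ) * θ) =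
        if k = 0 then 1 else 0 := by
      simp only [pow_zero, one_mul, integral_cos_nat_mul]
      split_ifs
      · field_simp
      · rw [mul_zero]
    rw [e']
    exact tendsto_const_nhds.congr fun n => (e n).symm
  | succ j ih =>
    -- shifted limits of the coefficients
    have hA' : ∀ i : ℕ, Tendsto (fun n => A (n + i)) atTop (𝓝 (1 / 2)) := fun i =>
      (tendsto_add_atTop_iff_nat i).2 hAlim
    have hB' : ∀ i : ℕ, Tendsto (fun n => B (n + i)) atTop (𝓝 0) := fun i =>
      (tendsto_add_atTop_iff_nat i).2 hBlim
    set Cj : ℕ → ℝ := fun k => π⁻¹ * ∫ θ in (0 : ℝ)..π, Real.cos θ ^ j * Real.cos ((k : ℝ) * θ)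
      with hCj
    -- the three pieces
    have T1 : Tendsto (fun n => A (n + k + 1) *
        ∫ ω, ω ^ j * ((p (n + 1)).eval ω * (p (n + k + 2)).eval ω) ∂τ) atTop
        (𝓝 (1 / 2 * Cj (k + 1))) := by
      refine (hA' (k + 1)).mul ((ih (k + 1)).congr fun n => ?_)
      rw [show n + 1 + (k + 1) = n + k + 2 by omega]
    have T2 : Tendsto (fun n => B (n + k + 1) *
        ∫ ω, ω ^ j * ((p (n + 1)).eval ω * (p (n + k + 1)).eval ω) ∂τ) atTop
        (𝓝 (0 * Cj k)) := by
      refine (hB' (k + 1)).mul ((ih k).congr fun n => ?_)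
      rw [show n + 1 + k = n + k + 1 by omega]
    rcases k with _ | k
    · -- `k = 0`
      have T3 : Tendsto (fun n => A (n + 0) *
          ∫ ω, ω ^ j * ((p (n + 1)).eval ω * (p (n + 0)).eval ω) ∂τ) atTop
          (𝓝 (1 / 2 * Cj 1)) := by
        refine (hA' 0).mul ?_
        have h1 : Tendsto (fun n => ∫ ω, ω ^ j * ((p (n + 1 + 1)).eval ω *
            (p (n + 1)).eval ω) ∂τ) atTop (𝓝 (Cj 1)) :=
          (ih 1).congr fun n => moment_symm j _ _
        exact ((tendsto_add_atTop_iff_nat (f := fun n => ∫ ω, ω ^ j * ((p (n + 1)).eval ω *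
          (p n).eval ω) ∂τ) 1).1 h1).congr fun n => by simp only [add_zero]
      have T := (T1.add T2).add T3
      have e' : π⁻¹ * ∫ θ in (0 : ℝ)..π, Real.cos θ ^ (j + 1) * Real.cos (((0 : ℕ) : ℝ) * θ) =
          1 / 2 * Cj (0 + 1) + 0 * Cj 0 + 1 / 2 * Cj 1 := by
        rw [chebMoment_succ_zero]; simp only [hCj, zero_add, Nat.cast_one]; ring
      rw [e']
      refine T.congr fun n => ?_
      rw [show n + 1 + 0 = n + 0 + 1 by omega,
        moment_succ hmom hdeg hlc horth hA hB j (n + 1) (n + 0)]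
    · -- `k + 1`
      have T3 : Tendsto (fun n => A (n + (k + 1)) *
          ∫ ω, ω ^ j * ((p (n + 1)).eval ω * (p (n + (k + 1))).eval ω) ∂τ) atTop
          (𝓝 (1 / 2 * Cj k)) := by
        refine (hA' (k + 1)).mul ((ih k).congr fun n => ?_)
        rw [show n + 1 + k = n + (k + 1) by omega]
      have T := (T1.add T2).add T3
      have e' : π⁻¹ * ∫ θ in (0 : ℝ)..π, Real.cos θ ^ (j + 1) * Real.cos (((k + 1 : ℕ) : ℝ) * θ) =
          1 / 2 * Cj (k + 1 + 1) + 0 * Cj (k + 1) + 1 / 2 * Cj k := by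
        rw [chebMoment_succ_succ]; simp only [hCj]; push_cast; ring
      rw [e']
      refine T.congr fun n => ?_
      rw [show n + 1 + (k + 1) = n + (k + 1) + 1 by omega,
        moment_succ hmom hdeg hlc horth hA hB j (n + 1) (n + (k + 1))]


/-- Weak convergence against POLYNOMIAL test functions:
`∫ q p_{n+1} p_{n+1+k} dτ → π⁻¹ ∫₀^π q(cos θ) cos(kθ) dθ`. [folklore] -/
theorem tendsto_integral_poly_mul (hAlim : Tendsto A atTop (𝓝 (1 / 2)))
    (hBlim : Tendsto B atTop (𝓝 0)) (q : ℝ[X]) (k : ℕ) :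
    Tendsto (fun n => ∫ ω, q.eval ω * ((p (n + 1)).eval ω * (p (n + 1 + k)).eval ω) ∂τ) atTop
      (𝓝 (π⁻¹ * ∫ θ in (0 : ℝ)..π, q.eval (Real.cos θ) * Real.cos ((k : ℝ) * θ))) := by
  have e1 : ∀ n, ∫ ω, q.eval ω * ((p (n + 1)).eval ω * (p (n + 1 + k)).eval ω) ∂τ =
      ∑ i ∈ Finset.range (q.natDegree + 1), q.coeff i *
        ∫ ω, ω ^ i * ((p (n + 1)).eval ω * (p (n + 1 + k)).eval ω) ∂τ := fun n => by
    have : ∀ ω, q.eval ω * ((p (n + 1)).eval ω * (p (n + 1 + k)).eval ω) =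
        ∑ i ∈ Finset.range (q.natDegree + 1), q.coeff i *
          (ω ^ i * ((p (n + 1)).eval ω * (p (n + 1 + k)).eval ω)) := fun ω => by
      rw [eval_eq_sum_range, Finset.sum_mul]; simp only [mul_assoc]
    simp_rw [this]
    rw [integral_finsetSum _ fun i _ => (integrable_pow_mul_eval_mul hmom i _ _).const_mul _]
    simp only [integral_const_mul]
  have e2 : π⁻¹ * ∫ θ in (0 : ℝ)..π, q.eval (Real.cos θ) * Real.cos ((k : ℝ) * θ) =
      ∑ i ∈ Finset.range (q.natDegree + 1), q.coeff i *
        (π⁻¹ * ∫ θ in (0 : ℝ)..π, Real.cos θ ^ i * Real.cos ((k : ℝ) * θ)) := by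
    have : ∀ θ, q.eval (Real.cos θ) * Real.cos ((k : ℝ) * θ) =
        ∑ i ∈ Finset.range (q.natDegree + 1),
          q.coeff i * (Real.cos θ ^ i * Real.cos ((k : ℝ) * θ)) :=
      fun θ => by rw [eval_eq_sum_range, Finset.sum_mul]; simp only [mul_assoc]
    simp_rw [this]
    rw [intervalIntegral.integral_finsetSum (fun i _ => ?_)]
    · simp only [intervalIntegral.integral_const_mul, Finset.mul_sum]
      exact Finset.sum_congr rfl fun i _ => by ring
    · exact (by fun_prop : Continuous fun θ =>
        q.coeff i * (Real.cos θ ^ i * Real.cos ((k : ℝ) * θ))).intervalIntegrable _ _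
  rw [e2]
  exact (tendsto_finsetSum _ fun i _ =>
    (tendsto_moment hmom hdeg hlc horth hA hB hAlim hBlim i k).const_mul (q.coeff i)).congr
    fun n => (e1 n).symm

/-- **Weak convergence against continuous test functions** (Nevai 1979, the class `M(0, 1)`):
for `f` continuous on `ℝ`, `∫ f p_{n+1} p_{n+1+k} dτ → π⁻¹ ∫₀^π f(cos θ) cos(kθ) dθ`
(`= π⁻¹ ∫_{-1}^1 f T_k (1-x²)^{-1/2} dx`). From the polynomial case by Weierstrass approximation on
the compact support `[-R, R]` of `τ` and `|p_a p_b| ≤ (p_a² + p_b²)/2`. [folklore] -/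
theorem tendsto_integral_continuous_mul (hAlim : Tendsto A atTop (𝓝 (1 / 2)))
    (hBlim : Tendsto B atTop (𝓝 0)) {f : ℝ → ℝ} (hf : Continuous f) (k : ℕ) :
    Tendsto (fun n => ∫ ω, f ω * ((p (n + 1)).eval ω * (p (n + 1 + k)).eval ω) ∂τ) atTop
      (𝓝 (π⁻¹ * ∫ θ in (0 : ℝ)..π, f (Real.cos θ) * Real.cos ((k : ℝ) * θ))) := by
  haveI := isFiniteMeasure_of_moments hmom
  -- compact support of `τ`
  obtain ⟨Ab, -, hAb⟩ := exists_abs_le_of_tendsto hAlim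
  obtain ⟨Bb, -, hBb⟩ := exists_abs_le_of_tendsto hBlim
  obtain ⟨R, hR1, hR⟩ := exists_ae_abs_le hmom hdeg hlc horth
    (fun n => by rw [← hA]; exact hAb n) (fun n => by rw [← hB]; exact hBb n)
  -- `f` is bounded on `[-R, R]`
  obtain ⟨Cf, hCf⟩ := isCompact_Icc.exists_bound_of_continuousOn
    (hf.continuousOn (s := Icc (-R) R))
  have hmemR : ∀ᵐ ω ∂τ, ω ∈ Icc (-R) R := hR.mono fun ω hω => abs_le.1 hω
  rw [Metric.tendsto_atTop]
  intro ε hε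
  have hε3 : 0 < ε / 3 := by positivity
  obtain ⟨q, hq⟩ := exists_polynomial_near_of_continuousOn (-R) R f hf.continuousOn (ε / 3) hε3
  have hlimq := tendsto_integral_poly_mul hmom hdeg hlc horth hA hB hAlim hBlim q k
  rw [Metric.tendsto_atTop] at hlimq
  obtain ⟨N, hN⟩ := hlimq (ε / 3) hε3
  refine ⟨N, fun n hn => ?_⟩
  have h2 := hN n hn
  -- abbreviations
  set P : ℝ → ℝ := fun ω => (p (n + 1)).eval ω * (p (n + 1 + k)).eval ω with hP
  have hPc : Continuous P := by simp only [hP]; fun_prop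
  have hPi : Integrable P τ := by
    simpa only [hP, pow_zero, one_mul] using integrable_pow_mul_eval_mul hmom 0 (n + 1) (n + 1 + k)
  have hsq : Integrable (fun ω => ((p (n + 1)).eval ω) ^ 2 + ((p (n + 1 + k)).eval ω) ^ 2) τ := by
    have h1 := integrable_eval_mul hmom (p (n + 1)) (p (n + 1))
    have h2 := integrable_eval_mul hmom (p (n + 1 + k)) (p (n + 1 + k))
    simp only [← sq] at h1 h2
    exact h1.add h2
  have hsq1 : ∫ ω, (((p (n + 1)).eval ω) ^ 2 + ((p (n + 1 + k)).eval ω) ^ 2) ∂τ = 2 := by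
    have h1 := integrable_eval_mul hmom (p (n + 1)) (p (n + 1))
    have h2 := integrable_eval_mul hmom (p (n + 1 + k)) (p (n + 1 + k))
    have e1 := horth (n + 1) (n + 1)
    have e2 := horth (n + 1 + k) (n + 1 + k)
    rw [if_pos rfl] at e1 e2
    simp only [← sq] at h1 h2 e1 e2
    rw [integral_add h1 h2, e1, e2]; norm_num
  have hPabs : ∀ ω, |P ω| ≤ (((p (n + 1)).eval ω) ^ 2 + ((p (n + 1 + k)).eval ω) ^ 2) / 2 :=
    fun ω => by
      rw [hP, abs_mul, le_div_iff₀ (by norm_num : (0 : ℝ) < 2), ← sq_abs ((p (n + 1)).eval ω),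
        ← sq_abs ((p (n + 1 + k)).eval ω)]
      nlinarith [two_mul_le_add_sq (|(p (n + 1)).eval ω|) (|(p (n + 1 + k)).eval ω|)]
  -- `f P` is integrable (τ is carried by `[-R, R]`, where `f` is bounded)
  have hfPi : Integrable (fun ω => f ω * P ω) τ := by
    refine Integrable.mono' (hPi.norm.const_mul Cf) ((hf.mul hPc).aestronglyMeasurable) ?_
    filter_upwards [hmemR] with ω hω
    rw [norm_mul]
    exact mul_le_mul_of_nonneg_right (hCf ω hω) (norm_nonneg _)
  have hqPi : Integrable (fun ω => q.eval ω * P ω) τ := by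
    simpa only [hP, pow_zero, one_mul] using ((integrable_eval hmom (q * (p (n + 1) *
      p (n + 1 + k)))).congr (Eventually.of_forall fun ω => by simp [eval_mul]))
  -- (1) `|∫ f P - ∫ q P| ≤ ε/3`
  have h1 : dist (∫ ω, f ω * P ω ∂τ) (∫ ω, q.eval ω * P ω ∂τ) ≤ ε / 3 := by
    rw [Real.dist_eq, ← integral_sub hfPi hqPi]
    have hbound : ∀ᵐ ω ∂τ, ‖f ω * P ω - q.eval ω * P ω‖ ≤
        ε / 3 * ((((p (n + 1)).eval ω) ^ 2 + ((p (n + 1 + k)).eval ω) ^ 2) / 2) := by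
      filter_upwards [hmemR] with ω hω
      rw [Real.norm_eq_abs, ← sub_mul, abs_mul]
      have hfq : |f ω - q.eval ω| ≤ ε / 3 := by rw [abs_sub_comm]; exact (hq ω hω).le
      exact mul_le_mul hfq (hPabs ω) (abs_nonneg _) hε3.le
    refine (norm_integral_le_of_norm_le ((hsq.div_const 2).const_mul _) hbound).trans (le_of_eq ?_)
    rw [integral_const_mul, integral_div, hsq1]; ring
  -- (3) `|L q - L f| ≤ ε/3`
  have h3 : dist (π⁻¹ * ∫ θ in (0 : ℝ)..π, q.eval (Real.cos θ) * Real.cos ((k : ℝ) * θ))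
      (π⁻¹ * ∫ θ in (0 : ℝ)..π, f (Real.cos θ) * Real.cos ((k : ℝ) * θ)) ≤ ε / 3 := by
    have hc1 : Continuous fun θ => q.eval (Real.cos θ) * Real.cos ((k : ℝ) * θ) := by fun_prop
    have hc2 : Continuous fun θ => f (Real.cos θ) * Real.cos ((k : ℝ) * θ) :=
      (hf.comp Real.continuous_cos).mul (by fun_prop)
    rw [Real.dist_eq, ← mul_sub, ← intervalIntegral.integral_sub (hc1.intervalIntegrable _ _)
      (hc2.intervalIntegrable _ _)]
    have hb : ∀ θ ∈ Set.uIoc (0 : ℝ) π, ‖q.eval (Real.cos θ) * Real.cos ((k : ℝ) * θ) -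
        f (Real.cos θ) * Real.cos ((k : ℝ) * θ)‖ ≤ ε / 3 := fun θ _ => by
      rw [Real.norm_eq_abs, ← sub_mul, abs_mul]
      have hcos : Real.cos θ ∈ Icc (-R) R :=
        ⟨by linarith [Real.neg_one_le_cos θ], by linarith [Real.cos_le_one θ]⟩
      calc |q.eval (Real.cos θ) - f (Real.cos θ)| * |Real.cos ((k : ℝ) * θ)|
          ≤ ε / 3 * 1 := mul_le_mul (hq _ hcos).le (Real.abs_cos_le_one _) (abs_nonneg _) hε3.le
        _ = ε / 3 := mul_one _
    have hI := intervalIntegral.norm_integral_le_of_norm_le_const hb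
    rw [Real.norm_eq_abs, sub_zero, abs_of_pos Real.pi_pos] at hI
    rw [abs_mul, abs_inv, abs_of_pos Real.pi_pos]
    calc π⁻¹ * |∫ θ in (0 : ℝ)..π, (q.eval (Real.cos θ) * Real.cos ((k : ℝ) * θ) -
          f (Real.cos θ) * Real.cos ((k : ℝ) * θ))| ≤ π⁻¹ * (ε / 3 * π) :=
          mul_le_mul_of_nonneg_left hI (inv_nonneg.2 Real.pi_pos.le)
      _ = ε / 3 := by field_simp
  calc dist (∫ ω, f ω * P ω ∂τ) (π⁻¹ * ∫ θ in (0 : ℝ)..π, f (Real.cos θ) * Real.cos ((k : ℝ) * θ))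
      ≤ dist (∫ ω, f ω * P ω ∂τ) (∫ ω, q.eval ω * P ω ∂τ) +
        dist (∫ ω, q.eval ω * P ω ∂τ)
          (π⁻¹ * ∫ θ in (0 : ℝ)..π, q.eval (Real.cos θ) * Real.cos ((k : ℝ) * θ)) +
        dist (π⁻¹ * ∫ θ in (0 : ℝ)..π, q.eval (Real.cos θ) * Real.cos ((k : ℝ) * θ))
          (π⁻¹ * ∫ θ in (0 : ℝ)..π, f (Real.cos θ) * Real.cos ((k : ℝ) * θ)) :=
        dist_triangle4 _ _ _ _
    _ < ε / 3 + ε / 3 + ε / 3 := by linarith [h1, h2, h3]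
    _ = ε := by ring

end WeakLimit


/-! ### The Turán determinant / discrete energy `S_n` (Dombrowski–Nevai (3)–(4)) -/

/-- The off-diagonal Jacobi coefficients `aₙ₊₁ = kₙ / kₙ₊₁` are positive. [folklore] -/
theorem A_pos {A : ℕ → ℝ} (hA : ∀ n, A n = (p n).leadingCoeff / (p (n + 1)).leadingCoeff)
    (hlc : ∀ n, 0 < (p n).leadingCoeff) (n : ℕ) : 0 < A n := by
  rw [hA]; exact div_pos (hlc n) (hlc (n + 1))

section Turan

variable (hmom : ∀ k : ℕ, Integrable (fun ω : ℝ => ω ^ k) τ)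
  (hdeg : ∀ n, (p n).natDegree = n) (hlc : ∀ n, 0 < (p n).leadingCoeff)
  (horth : ∀ m n, ∫ ω, (p m).eval ω * (p n).eval ω ∂τ = if m = n then 1 else 0)
  {A B : ℕ → ℝ} (hA : ∀ n, A n = (p n).leadingCoeff / (p (n + 1)).leadingCoeff)
  (hB : ∀ n, B n = ∫ ω, ω * ((p n).eval ω) ^ 2 ∂τ)
  {S : ℕ → ℝ → ℝ} (hS : ∀ n x, S n x = A (n + 1) * ((p (n + 1)).eval x) ^ 2 -
    (x - B (n + 1)) * ((p (n + 1)).eval x * (p n).eval x) + A n * ((p n).eval x) ^ 2)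

include hmom hdeg hlc horth hA hB

/-- **Consecutive orthogonal polynomials have no common zero**: `p_{n+1}(x)² + p_n(x)² > 0`
(from the recurrence, by downward induction to `p_0 ≠ 0`). [folklore] -/
theorem sq_add_sq_pos (n : ℕ) (x : ℝ) : 0 < ((p (n + 1)).eval x) ^ 2 + ((p n).eval x) ^ 2 := by
  have key : ∀ n, ¬ ((p (n + 1)).eval x = 0 ∧ (p n).eval x = 0) := by
    intro n
    induction n with
    | zero =>
      rintro ⟨-, h0⟩
      have hp0 : p 0 = C ((p 0).leadingCoeff) := by
        conv_lhs => rw [eq_C_of_natDegree_eq_zero (hdeg 0)]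
        rw [← coeff_natDegree, hdeg 0]
      rw [hp0, eval_C] at h0
      exact (hlc 0).ne' h0
    | succ n ih =>
      rintro ⟨h2, h1⟩
      have h := recurrence_eval hmom hdeg hlc horth hA hB n x
      rw [h1, h2, mul_zero, mul_zero, mul_zero, zero_add, zero_add] at h
      have hAn : A n ≠ 0 := (A_pos hA hlc n).ne'
      exact ih ⟨h1, (mul_eq_zero.1 h.symm).resolve_left hAn⟩
  by_contra h
  have h' : ((p (n + 1)).eval x) ^ 2 + ((p n).eval x) ^ 2 = 0 :=
    le_antisymm (not_lt.1 h) (by positivity)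
  have h1 : (p (n + 1)).eval x = 0 := by
    nlinarith [sq_nonneg ((p (n + 1)).eval x), sq_nonneg ((p n).eval x)]
  have h2 : (p n).eval x = 0 := by
    nlinarith [sq_nonneg ((p (n + 1)).eval x), sq_nonneg ((p n).eval x)]
  exact key n ⟨h1, h2⟩

include hS

/-- **Turán form of `S_n`** (Dombrowski–Nevai (4)): `S_n = a_{n+2} (p_{n+1}² - p_{n+2} p_n)`.
[cite: DombrowskiNevai1986, (4)] -/
theorem S_eq_turan (n : ℕ) (x : ℝ) :
    S n x = A (n + 1) * (((p (n + 1)).eval x) ^ 2 - (p (n + 2)).eval x * (p n).eval x) := by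
  have h := recurrence_eval hmom hdeg hlc horth hA hB n x
  rw [hS]
  linear_combination (-(p n).eval x) * h

/-- **Variation of `S_n`** (Dombrowski–Nevai, proof of Lemma 1):
`S_{n+1} - S_n = Δa p_{n+2}² + Δa' p_{n+2} p_n + Δb p_{n+1} p_{n+2}`.
[cite: DombrowskiNevai1986, Lemma 1] -/
theorem S_succ_sub (n : ℕ) (x : ℝ) :
    S (n + 1) x - S n x = (A (n + 2) - A (n + 1)) * ((p (n + 2)).eval x) ^ 2 +
      (A (n + 1) - A n) * ((p (n + 2)).eval x * (p n).eval x) +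
      (B (n + 2) - B (n + 1)) * ((p (n + 1)).eval x * (p (n + 2)).eval x) := by
  have h := recurrence_eval hmom hdeg hlc horth hA hB n x
  rw [hS, hS]
  linear_combination ((p n).eval x - (p (n + 2)).eval x) * h

omit hmom hdeg hlc horth hA hB in
/-- **Positivity of `S_n` inside `(-1, 1)`** (Dombrowski–Nevai (5)–(6)): if `|x| ≤ r < 1` and the
coefficients are `δ = (1-r)/6`-close to their limits, `S_n(x) ≥ ¼(1-r)(p_{n+1}(x)² + p_n(x)²)`.
[cite: DombrowskiNevai1986, Lemma 1] -/
theorem S_lower {r : ℝ} {n : ℕ} {x : ℝ} (hx : |x| ≤ r)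
    (hA1 : |A (n + 1) - 1 / 2| ≤ (1 - r) / 6) (hA0 : |A n - 1 / 2| ≤ (1 - r) / 6)
    (hB1 : |B (n + 1)| ≤ (1 - r) / 6) :
    (1 - r) / 4 * (((p (n + 1)).eval x) ^ 2 + ((p n).eval x) ^ 2) ≤ S n x := by
  rw [hS]
  set u := (p (n + 1)).eval x
  set v := (p n).eval x
  have hr1 : r ≤ 1 := by
    have := abs_nonneg (A n - 1 / 2); linarith
  have hxB : |x - B (n + 1)| ≤ r + (1 - r) / 6 :=
    (abs_sub _ _).trans (add_le_add hx hB1)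
  have huv : |u * v| ≤ (u ^ 2 + v ^ 2) / 2 := by
    rw [abs_mul, le_div_iff₀ (by norm_num : (0 : ℝ) < 2), ← sq_abs u, ← sq_abs v]
    nlinarith [two_mul_le_add_sq (|u|) (|v|)]
  have hcross : (x - B (n + 1)) * (u * v) ≤ (r + (1 - r) / 6) * ((u ^ 2 + v ^ 2) / 2) :=
    calc (x - B (n + 1)) * (u * v) ≤ |(x - B (n + 1)) * (u * v)| := le_abs_self _
      _ = |x - B (n + 1)| * |u * v| := abs_mul _ _
      _ ≤ (r + (1 - r) / 6) * ((u ^ 2 + v ^ 2) / 2) :=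
        mul_le_mul hxB huv (abs_nonneg _) (by linarith [abs_nonneg x])
  have hA1' : 1 / 2 - (1 - r) / 6 ≤ A (n + 1) := by linarith [(abs_le.1 hA1).1]
  have hA0' : 1 / 2 - (1 - r) / 6 ≤ A n := by linarith [(abs_le.1 hA0).1]
  nlinarith [mul_le_mul_of_nonneg_right hA1' (sq_nonneg u),
    mul_le_mul_of_nonneg_right hA0' (sq_nonneg v)]

/-- **Multiplicative bounded-variation estimate** (Dombrowski–Nevai (10), additive form):
`|S_{n+1} - S_n| ≤ (εₙ / c) (S_{n+1} + S_n)` on `|x| ≤ r`, `c = (1-r)/4`,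
`εₙ = |Δa| + |Δa'| + |Δb|`. [cite: DombrowskiNevai1986, Lemma 1 (10)] -/
theorem abs_S_succ_sub_le {r : ℝ} {n : ℕ} {x : ℝ} (hr : r < 1) (hx : |x| ≤ r)
    (hA2 : |A (n + 2) - 1 / 2| ≤ (1 - r) / 6) (hA1 : |A (n + 1) - 1 / 2| ≤ (1 - r) / 6)
    (hA0 : |A n - 1 / 2| ≤ (1 - r) / 6) (hB2 : |B (n + 2)| ≤ (1 - r) / 6)
    (hB1 : |B (n + 1)| ≤ (1 - r) / 6) :
    |S (n + 1) x - S n x| ≤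
      (|A (n + 2) - A (n + 1)| + |A (n + 1) - A n| + |B (n + 2) - B (n + 1)|) /
        ((1 - r) / 4) * (S (n + 1) x + S n x) := by
  set c := (1 - r) / 4 with hc
  have hc0 : 0 < c := by rw [hc]; linarith
  set u := (p (n + 1)).eval x with hu
  set v := (p n).eval x with hv
  set w := (p (n + 2)).eval x with hw
  have hSn : c * (u ^ 2 + v ^ 2) ≤ S n x := S_lower hS hx hA1 hA0 hB1
  have hSn1 : c * (w ^ 2 + u ^ 2) ≤ S (n + 1) x := S_lower hS hx hA2 hA1 hB2
  have hSn0 : 0 ≤ S n x := le_trans (by positivity) hSn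
  have hSn10 : 0 ≤ S (n + 1) x := le_trans (by positivity) hSn1
  set T := (S (n + 1) x + S n x) / c with hT
  -- `|yz| ≤ (y² + z²)/2`
  have habs : ∀ y z : ℝ, |y * z| ≤ (y ^ 2 + z ^ 2) / 2 := fun y z => by
    rw [abs_mul, le_div_iff₀ (by norm_num : (0 : ℝ) < 2), ← sq_abs y, ← sq_abs z]
    nlinarith [two_mul_le_add_sq (|y|) (|z|)]
  have h1 : w ^ 2 ≤ T := by
    rw [hT, le_div_iff₀ hc0]; nlinarith [sq_nonneg u]
  have h2 : |w * v| ≤ T := by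
    refine (habs w v).trans ?_
    rw [hT, le_div_iff₀ hc0]; nlinarith [sq_nonneg u]
  have h3 : |u * w| ≤ T := by
    refine (habs u w).trans ?_
    rw [hT, le_div_iff₀ hc0]; nlinarith [sq_nonneg v]
  have hT0 : 0 ≤ T := le_trans (sq_nonneg w) h1
  rw [S_succ_sub hmom hdeg hlc horth hA hB hS n x]
  calc |(A (n + 2) - A (n + 1)) * w ^ 2 + (A (n + 1) - A n) * (w * v) +
        (B (n + 2) - B (n + 1)) * (u * w)|
      ≤ |(A (n + 2) - A (n + 1)) * w ^ 2| + |(A (n + 1) - A n) * (w * v)| +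
        |(B (n + 2) - B (n + 1)) * (u * w)| :=
        (abs_add_le _ _).trans (add_le_add (abs_add_le _ _) le_rfl)
    _ = |A (n + 2) - A (n + 1)| * w ^ 2 + |A (n + 1) - A n| * |w * v| +
        |B (n + 2) - B (n + 1)| * |u * w| := by
        rw [abs_mul (A (n + 2) - A (n + 1)) (w ^ 2), abs_mul (A (n + 1) - A n) (w * v),
          abs_mul (B (n + 2) - B (n + 1)) (u * w), abs_of_nonneg (sq_nonneg w)]
    _ ≤ |A (n + 2) - A (n + 1)| * T + |A (n + 1) - A n| * T + |B (n + 2) - B (n + 1)| * T := by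
        gcongr
    _ = (|A (n + 2) - A (n + 1)| + |A (n + 1) - A n| + |B (n + 2) - B (n + 1)|) / c *
        (S (n + 1) x + S n x) := by
        rw [hT]; field_simp

end Turan

/-! ### A discrete Grönwall lemma for log-variations -/

/-- If `|t - s| ≤ d (t + s)` with `s, t > 0` and `d ≤ 1/2`, then `|log t - log s| ≤ 4 d`.
[folklore] -/
theorem abs_log_sub_log_le {s t d : ℝ} (hs : 0 < s) (ht : 0 < t) (hd : d ≤ 1 / 2)
    (h : |t - s| ≤ d * (t + s)) : |Real.log t - Real.log s| ≤ 4 * d := by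
  have hd0 : 0 ≤ d := by
    by_contra hneg
    have : d * (t + s) < 0 := mul_neg_of_neg_of_pos (not_le.1 hneg) (by linarith)
    linarith [abs_nonneg (t - s)]
  have h1 : t - s ≤ d * (t + s) := (le_abs_self _).trans h
  have h2 : s - t ≤ d * (t + s) := by linarith [neg_abs_le (t - s)]
  -- `t / s ≤ (1 + d)/(1 - d)` hence `log t - log s ≤ t/s - 1 ≤ 2d/(1-d) ≤ 4d`, and symmetrically
  have key : ∀ {a b : ℝ}, 0 < a → 0 < b → a - b ≤ d * (a + b) →
      Real.log a - Real.log b ≤ 4 * d := by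
    intro a b ha hb hab
    have hab' : a * (1 - d) ≤ b * (1 + d) := by nlinarith
    have h1d : 0 < 1 - d := by linarith
    calc Real.log a - Real.log b = Real.log (a / b) := (Real.log_div ha.ne' hb.ne').symm
      _ ≤ a / b - 1 := Real.log_le_sub_one_of_pos (div_pos ha hb)
      _ ≤ (1 + d) / (1 - d) - 1 := by
          rw [sub_le_sub_iff_right, div_le_div_iff₀ hb h1d]; linarith
      _ = 2 * d / (1 - d) := by rw [div_sub_one h1d.ne']; ring
      _ ≤ 4 * d := by
          rw [div_le_iff₀ h1d]; nlinarith
  rw [abs_le]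
  constructor
  · have := key hs ht (by linarith [h2])
    linarith
  · exact key ht hs (by linarith [h1])

/-- **Discrete Grönwall**: if `s_n > 0` and `|s_{n+1} - s_n| ≤ d_n (s_{n+1} + s_n)` with
`0 ≤ d_n ≤ 1/2` summable, for `n ≥ N`, then `|log s_n - log s_N| ≤ 4 Σ d` for all `n ≥ N`.
[folklore] -/
theorem abs_log_sub_log_le_tsum {s d : ℕ → ℝ} {N : ℕ} (hpos : ∀ n, N ≤ n → 0 < s n)
    (hd0 : ∀ n, 0 ≤ d n) (hd : ∀ n, N ≤ n → d n ≤ 1 / 2) (hsum : Summable d)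
    (h : ∀ n, N ≤ n → |s (n + 1) - s n| ≤ d n * (s (n + 1) + s n)) (n : ℕ) (hn : N ≤ n) :
    |Real.log (s n) - Real.log (s N)| ≤ 4 * ∑' i, d i := by
  suffices H : |Real.log (s n) - Real.log (s N)| ≤ 4 * ∑ i ∈ Finset.Ico N n, d i by
    refine H.trans (mul_le_mul_of_nonneg_left ?_ (by norm_num))
    exact hsum.sum_le_tsum _ fun i _ => hd0 i
  induction n, hn using Nat.le_induction with
  | base => simp
  | succ n hn ih =>
    have hstep := abs_log_sub_log_le (hpos n hn) (hpos (n + 1) (by omega)) (hd n hn) (h n hn)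
    rw [Finset.sum_Ico_succ_top hn, mul_add]
    calc |Real.log (s (n + 1)) - Real.log (s N)|
        ≤ |Real.log (s (n + 1)) - Real.log (s n)| + |Real.log (s n) - Real.log (s N)| :=
          abs_sub_le _ _ _
      _ ≤ 4 * d n + 4 * ∑ i ∈ Finset.Ico N n, d i := add_le_add hstep ih
      _ = 4 * ∑ i ∈ Finset.Ico N n, d i + 4 * d n := add_comm _ _


/-! ### Uniform bounds and uniform convergence of `S_n` on compact subsets of `(-1, 1)` -/

section TuranLimit

variable (hmom : ∀ k : ℕ, Integrable (fun ω : ℝ => ω ^ k) τ)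
  (hdeg : ∀ n, (p n).natDegree = n) (hlc : ∀ n, 0 < (p n).leadingCoeff)
  (horth : ∀ m n, ∫ ω, (p m).eval ω * (p n).eval ω ∂τ = if m = n then 1 else 0)
  {A B : ℕ → ℝ} (hA : ∀ n, A n = (p n).leadingCoeff / (p (n + 1)).leadingCoeff)
  (hB : ∀ n, B n = ∫ ω, ω * ((p n).eval ω) ^ 2 ∂τ)
  {S : ℕ → ℝ → ℝ} (hS : ∀ n x, S n x = A (n + 1) * ((p (n + 1)).eval x) ^ 2 -
    (x - B (n + 1)) * ((p (n + 1)).eval x * (p n).eval x) + A n * ((p n).eval x) ^ 2)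
  (hAlim : Tendsto A atTop (𝓝 (1 / 2))) (hBlim : Tendsto B atTop (𝓝 0))
  (hAbv : Summable (fun n => |A (n + 1) - A n|)) (hBbv : Summable (fun n => |B (n + 1) - B n|))
include hmom hdeg hlc horth hA hB hS hAlim hBlim hAbv hBbv

/-- **Uniform bounds for the Turán determinants** (Dombrowski–Nevai, Lemma 1 and proof of
Thm 2; Máté–Nevai): on `|x| ≤ r < 1`, for `n ≥ N`, `0 < m ≤ S_n(x) ≤ M` and
`|S_{n+1}(x) - S_n(x)| ≤ u_n` with `Σ u_n < ∞`. [cite: DombrowskiNevai1986, Lemma 1] -/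
theorem S_bounds {r : ℝ} (hr0 : 0 ≤ r) (hr : r < 1) :
    ∃ (N : ℕ) (m M : ℝ) (u : ℕ → ℝ), 0 < m ∧ Summable u ∧
      ∀ n, N ≤ n → ∀ x, |x| ≤ r → m ≤ S n x ∧ S n x ≤ M ∧ |S (n + 1) x - S n x| ≤ u n := by
  set δ := (1 - r) / 6 with hδ
  have hδ0 : 0 < δ := by rw [hδ]; linarith
  set c := (1 - r) / 4 with hc
  have hc0 : 0 < c := by rw [hc]; linarith
  -- eventually the coefficients are `δ`-close to their limits
  obtain ⟨N₀, hN₀⟩ : ∃ N₀, ∀ n, N₀ ≤ n → |A n - 1 / 2| ≤ δ ∧ |B n| ≤ δ := by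
    obtain ⟨Na, hNa⟩ := (Metric.tendsto_atTop.1 hAlim) δ hδ0
    obtain ⟨Nb, hNb⟩ := (Metric.tendsto_atTop.1 hBlim) δ hδ0
    refine ⟨max Na Nb, fun n hn => ⟨?_, ?_⟩⟩
    · have h := hNa n (le_of_max_le_left hn); rw [Real.dist_eq] at h; exact h.le
    · have h := hNb n (le_of_max_le_right hn); rw [Real.dist_eq, sub_zero] at h; exact h.le
  -- the summable variation
  set ε : ℕ → ℝ := fun n =>
    |A (n + 2) - A (n + 1)| + |A (n + 1) - A n| + |B (n + 2) - B (n + 1)| with hε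
  have hε0 : ∀ n, 0 ≤ ε n := fun n => by positivity
  have hεsum : Summable ε := by
    have h1 : Summable (fun n => |A (n + 2) - A (n + 1)|) :=
      (summable_nat_add_iff (f := fun n => |A (n + 1) - A n|) 1).2 hAbv
    have h3 : Summable (fun n => |B (n + 2) - B (n + 1)|) :=
      (summable_nat_add_iff (f := fun n => |B (n + 1) - B n|) 1).2 hBbv
    exact (h1.add hAbv).add h3
  set d : ℕ → ℝ := fun n => ε n / c with hd
  have hd0 : ∀ n, 0 ≤ d n := fun n => div_nonneg (hε0 n) hc0.le
  have hdsum : Summable d := hεsum.div_const c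
  obtain ⟨N₁, hN₁⟩ : ∃ N₁, ∀ n, N₁ ≤ n → d n ≤ 1 / 2 := by
    obtain ⟨N₁, hN₁⟩ := (Metric.tendsto_atTop.1 hdsum.tendsto_atTop_zero) (1 / 2) (by norm_num)
    exact ⟨N₁, fun n hn => by
      have h := hN₁ n hn
      rw [Real.dist_eq, sub_zero] at h
      exact (le_abs_self _).trans h.le⟩
  set N := max N₀ N₁ with hN
  -- positivity and the variation inequality for `n ≥ N₀`
  have hlow : ∀ n, N₀ ≤ n → ∀ x, |x| ≤ r →
      c * (((p (n + 1)).eval x) ^ 2 + ((p n).eval x) ^ 2) ≤ S n x := fun n hn x hx =>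
    S_lower hS hx (hN₀ (n + 1) (by omega)).1 (hN₀ n hn).1 (hN₀ (n + 1) (by omega)).2
  have hposS : ∀ n, N₀ ≤ n → ∀ x, |x| ≤ r → 0 < S n x := fun n hn x hx =>
    lt_of_lt_of_le (mul_pos hc0 (sq_add_sq_pos hmom hdeg hlc horth hA hB n x)) (hlow n hn x hx)
  have hvar : ∀ n, N₀ ≤ n → ∀ x, |x| ≤ r →
      |S (n + 1) x - S n x| ≤ d n * (S (n + 1) x + S n x) := fun n hn x hx =>
    abs_S_succ_sub_le hmom hdeg hlc horth hA hB hS hr hx (hN₀ (n + 2) (by omega)).1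
      (hN₀ (n + 1) (by omega)).1 (hN₀ n hn).1 (hN₀ (n + 2) (by omega)).2
      (hN₀ (n + 1) (by omega)).2
  -- bounds for `S N` on `[-r, r]` (compactness)
  have hScont : ∀ n, Continuous (S n) := fun n => by
    rw [show S n = _ from funext (hS n)]; fun_prop
  have hcont : ContinuousOn (S N) (Icc (-r) r) := (hScont N).continuousOn
  have hne : (Icc (-r) r).Nonempty := ⟨0, by constructor <;> linarith⟩
  obtain ⟨x₀, hx₀, hmin⟩ := isCompact_Icc.exists_isMinOn hne hcont
  obtain ⟨x₁, hx₁, hmax⟩ := isCompact_Icc.exists_isMaxOn hne hcont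
  rw [isMinOn_iff] at hmin
  rw [isMaxOn_iff] at hmax
  have habs : ∀ {x}, x ∈ Icc (-r) r → |x| ≤ r := fun hx => abs_le.2 ⟨hx.1, hx.2⟩
  have hIcc : ∀ {x : ℝ}, |x| ≤ r → x ∈ Icc (-r) r := fun hx => ⟨(abs_le.1 hx).1, (abs_le.1 hx).2⟩
  have hm₀ : 0 < S N x₀ := hposS N (le_max_left _ _) x₀ (habs hx₀)
  set D := 4 * ∑' i, d i with hD
  -- discrete Grönwall
  have hlog : ∀ x, |x| ≤ r → ∀ n, N ≤ n →
      |Real.log (S n x) - Real.log (S N x)| ≤ D := fun x hx n hn =>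
    abs_log_sub_log_le_tsum (s := fun n => S n x)
      (fun k hk => hposS k (le_trans (le_max_left _ _) hk) x hx) hd0
      (fun k hk => hN₁ k (le_trans (le_max_right _ _) hk)) hdsum
      (fun k hk => hvar k (le_trans (le_max_left _ _) hk) x hx) n hn
  have hup : ∀ x, |x| ≤ r → ∀ k, N ≤ k → S k x ≤ S N x₁ * Real.exp D := fun x hx k hk => by
    have hlk := hlog x hx k hk
    have hSk := hposS k (le_trans (le_max_left _ _) hk) x hx
    have hSN := hposS N (le_max_left _ _) x hx
    have h1 : Real.log (S k x) ≤ Real.log (S N x) + D := by linarith [(abs_le.1 hlk).2]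
    have hM₀pos : 0 < S N x₁ := lt_of_lt_of_le hSN (hmax x (hIcc hx))
    have h2 : Real.log (S N x) ≤ Real.log (S N x₁) := Real.log_le_log hSN (hmax x (hIcc hx))
    calc S k x = Real.exp (Real.log (S k x)) := (Real.exp_log hSk).symm
      _ ≤ Real.exp (Real.log (S N x₁) + D) := Real.exp_le_exp.2 (by linarith)
      _ = S N x₁ * Real.exp D := by rw [Real.exp_add, Real.exp_log hM₀pos]
  refine ⟨N, S N x₀ * Real.exp (-D), S N x₁ * Real.exp D,
    fun n => d n * (2 * (S N x₁ * Real.exp D)), mul_pos hm₀ (Real.exp_pos _),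
    hdsum.mul_right _, fun n hn x hx => ⟨?_, hup x hx n hn, ?_⟩⟩
  · have hSN := hposS N (le_max_left _ _) x hx
    have hSn := hposS n (le_trans (le_max_left _ _) hn) x hx
    have hl := hlog x hx n hn
    have h1 : Real.log (S N x) - D ≤ Real.log (S n x) := by linarith [(abs_le.1 hl).1]
    have h2 : Real.log (S N x₀) ≤ Real.log (S N x) := Real.log_le_log hm₀ (hmin x (hIcc hx))
    calc S N x₀ * Real.exp (-D) = Real.exp (Real.log (S N x₀) - D) := by
          rw [Real.exp_sub, Real.exp_log hm₀, Real.exp_neg, div_eq_mul_inv]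
      _ ≤ Real.exp (Real.log (S n x)) := Real.exp_le_exp.2 (by linarith)
      _ = S n x := Real.exp_log hSn
  · calc |S (n + 1) x - S n x| ≤ d n * (S (n + 1) x + S n x) :=
          hvar n (le_trans (le_max_left _ _) hn) x hx
      _ ≤ d n * (2 * (S N x₁ * Real.exp D)) :=
          mul_le_mul_of_nonneg_left (by linarith [hup x hx (n + 1) (by omega), hup x hx n hn])
            (hd0 n)

/-- **The Turán determinants converge locally uniformly on `(-1, 1)` to a continuous positive
limit** (Máté–Nevai 1983; Dombrowski–Nevai Thm 1): with `S∞(x) = lim S_n(x)`, `S∞` is continuous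
and positive on `(-1, 1)` and `sup_{|x| ≤ r} |S_n - S∞| → 0` for every `r < 1`.
[cite: DombrowskiNevai1986, Thm 1] -/
theorem S_limit :
    ContinuousOn (fun x => limUnder atTop (fun n => S n x)) (Ioo (-1) 1) ∧
    (∀ x ∈ Ioo (-1 : ℝ) 1, 0 < limUnder atTop (fun n => S n x)) ∧
    ∀ r, 0 ≤ r → r < 1 → ∃ (N : ℕ) (ρ : ℕ → ℝ), Tendsto ρ atTop (𝓝 0) ∧
      ∀ n, N ≤ n → ∀ x, |x| ≤ r → |S n x - limUnder atTop (fun n => S n x)| ≤ ρ n := by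
  -- the key estimate on `[-r, r]`
  have key : ∀ r, 0 ≤ r → r < 1 → ∃ (N : ℕ) (m : ℝ) (ρ : ℕ → ℝ), 0 < m ∧
      Tendsto ρ atTop (𝓝 0) ∧ ∀ x, |x| ≤ r →
        Tendsto (fun n => S n x) atTop (𝓝 (limUnder atTop (fun n => S n x))) ∧
        m ≤ limUnder atTop (fun n => S n x) ∧
        ∀ n, N ≤ n → |S n x - limUnder atTop (fun n => S n x)| ≤ ρ n := by
    intro r hr0 hr
    obtain ⟨N, m, M, u, hm, hu, h⟩ :=
      S_bounds hmom hdeg hlc horth hA hB hS hAlim hBlim hAbv hBbv hr0 hr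
    have hu0 : ∀ n, N ≤ n → 0 ≤ u n := fun n hn =>
      (abs_nonneg _).trans (h n hn 0 (by rw [abs_zero]; exact hr0)).2.2
    -- `ρ n = Σ_{k} u (k + n)` for `n ≥ N`
    refine ⟨N, m, fun n => ∑' k, u (k + n), hm, tendsto_sum_nat_add u, fun x hx => ?_⟩
    set f : ℕ → ℝ := fun i => S (i + N) x with hf
    have hdist : ∀ i, dist (f i) (f (i + 1)) ≤ u (i + N) := fun i => by
      rw [hf, Real.dist_eq, abs_sub_comm]
      show |S (i + 1 + N) x - S (i + N) x| ≤ u (i + N)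
      rw [show i + 1 + N = i + N + 1 by omega]
      exact (h (i + N) (by omega) x hx).2.2
    have hu' : Summable (fun i => u (i + N)) := (summable_nat_add_iff N).2 hu
    have hcauchy : CauchySeq f := cauchySeq_of_dist_le_of_summable _ hdist hu'
    obtain ⟨L, hL⟩ := cauchySeq_tendsto_of_complete hcauchy
    have hL' : Tendsto (fun n => S n x) atTop (𝓝 L) := (tendsto_add_atTop_iff_nat N).1 hL
    have hLeq : limUnder atTop (fun n => S n x) = L := hL'.limUnder_eq
    rw [hLeq]
    refine ⟨hL', ?_, fun n hn => ?_⟩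
    · exact ge_of_tendsto hL' (eventually_atTop.2 ⟨N, fun n hn => (h n hn x hx).1⟩)
    · have hb := dist_le_tsum_of_dist_le_of_tendsto _ hdist hu' hL (n - N)
      rw [hf, Real.dist_eq] at hb
      simp only [show n - N + N = n by omega] at hb
      refine hb.trans (le_of_eq (tsum_congr fun k => ?_))
      congr 1; omega
  refine ⟨?_, fun x hx => ?_, fun r hr0 hr => ?_⟩
  · -- continuity: locally uniform limit of continuous functions
    intro x₀ hx₀
    set r := (|x₀| + 1) / 2 with hr
    have hx₀' : |x₀| < 1 := abs_lt.2 ⟨hx₀.1, hx₀.2⟩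
    have hr0 : 0 ≤ r := by rw [hr]; positivity
    have hr1 : r < 1 := by rw [hr]; linarith
    have hxr : |x₀| < r := by rw [hr]; linarith
    obtain ⟨N, m, ρ, -, hρ, h⟩ := key r hr0 hr1
    have hunif : TendstoUniformlyOn (fun n x => S n x) (fun x => limUnder atTop (fun n => S n x))
        atTop (Icc (-r) r) := by
      rw [Metric.tendstoUniformlyOn_iff]
      intro ε hε
      have hev : ∀ᶠ n in atTop, ρ n < ε ∧ N ≤ n :=
        ((Metric.tendsto_atTop.1 hρ) ε hε |> fun ⟨N', hN'⟩ => eventually_atTop.2 ⟨max N N',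
          fun n hn => ⟨by have := hN' n (le_of_max_le_right hn); rw [Real.dist_eq, sub_zero] at this
                          exact (le_abs_self _).trans_lt this, le_of_max_le_left hn⟩⟩)
      filter_upwards [hev] with n hn x hx
      rw [dist_comm, Real.dist_eq]
      exact ((h x (abs_le.2 ⟨hx.1, hx.2⟩)).2.2 n hn.2).trans_lt hn.1
    have hcont : ContinuousOn (fun x => limUnder atTop (fun n => S n x)) (Icc (-r) r) :=
      hunif.continuousOn (Frequently.of_forall fun n => Continuous.continuousOn (by
        rw [show S n = _ from funext (hS n)]; fun_prop))
    exact (hcont.continuousAt (Icc_mem_nhds (by linarith [(abs_lt.1 hxr).1])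
      (by linarith [(abs_lt.1 hxr).2]))).continuousWithinAt
  · -- positivity
    have hx' : |x| < 1 := abs_lt.2 ⟨hx.1, hx.2⟩
    obtain ⟨N, m, ρ, hm, -, h⟩ := key |x| (abs_nonneg x) hx'
    exact lt_of_lt_of_le hm (h x le_rfl).2.1
  · obtain ⟨N, m, ρ, -, hρ, h⟩ := key r hr0 hr
    exact ⟨N, ρ, hρ, fun n hn x hx => (h x hx).2.2 n hn⟩

end TuranLimit


/-! ### The substitution `x = cos θ` -/

/-- `∫₀^π F(cos θ) sin² θ dθ = ∫_{-1}^1 F(x) √(1 - x²) dx` for continuous `F`. [folklore] -/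
theorem integral_comp_cos_mul_sin_sq {F : ℝ → ℝ} (hF : Continuous F) :
    ∫ θ in (0 : ℝ)..π, F (Real.cos θ) * Real.sin θ ^ 2 =
      ∫ x in (-1 : ℝ)..1, F x * Real.sqrt (1 - x ^ 2) := by
  have hg : Continuous fun x => F x * Real.sqrt (1 - x ^ 2) := by fun_prop
  have hsub := intervalIntegral.integral_comp_mul_deriv (a := 0) (b := π) (f := Real.cos)
    (f' := fun θ => -Real.sin θ) (g := fun x => F x * Real.sqrt (1 - x ^ 2))
    (fun θ _ => Real.hasDerivAt_cos θ) (by fun_prop) hg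
  rw [Real.cos_zero, Real.cos_pi, intervalIntegral.integral_symm (-1) 1] at hsub
  have h2 : ∫ θ in (0 : ℝ)..π, ((fun x => F x * Real.sqrt (1 - x ^ 2)) ∘ Real.cos) θ *
      -Real.sin θ = -∫ θ in (0 : ℝ)..π, F (Real.cos θ) * Real.sin θ ^ 2 := by
    rw [← intervalIntegral.integral_neg]
    refine intervalIntegral.integral_congr fun θ hθ => ?_
    rw [uIcc_of_le Real.pi_pos.le] at hθ
    have hsin : 0 ≤ Real.sin θ := Real.sin_nonneg_of_nonneg_of_le_pi hθ.1 hθ.2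
    simp only [Function.comp_apply]
    rw [← Real.sin_sq, Real.sqrt_sq hsin]
    ring
  rw [h2] at hsub
  linarith

/-! ### Identification of the limit: `S∞ dτ = π⁻¹ √(1-x²) dx` on `(-1, 1)` -/

section Identification

variable (hmom : ∀ k : ℕ, Integrable (fun ω : ℝ => ω ^ k) τ)
  (hdeg : ∀ n, (p n).natDegree = n) (hlc : ∀ n, 0 < (p n).leadingCoeff)
  (horth : ∀ m n, ∫ ω, (p m).eval ω * (p n).eval ω ∂τ = if m = n then 1 else 0)
  {A B : ℕ → ℝ} (hA : ∀ n, A n = (p n).leadingCoeff / (p (n + 1)).leadingCoeff)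
  (hB : ∀ n, B n = ∫ ω, ω * ((p n).eval ω) ^ 2 ∂τ)
  {S : ℕ → ℝ → ℝ} (hS : ∀ n x, S n x = A (n + 1) * ((p (n + 1)).eval x) ^ 2 -
    (x - B (n + 1)) * ((p (n + 1)).eval x * (p n).eval x) + A n * ((p n).eval x) ^ 2)
  (hAlim : Tendsto A atTop (𝓝 (1 / 2))) (hBlim : Tendsto B atTop (𝓝 0))
include hmom hdeg hlc horth hA hB hAlim hBlim

/-- Every continuous function is `τ`-integrable (`τ` is finite and compactly supported).
[folklore] -/
theorem integrable_continuous {F : ℝ → ℝ} (hF : Continuous F) : Integrable F τ := by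
  haveI := isFiniteMeasure_of_moments hmom
  obtain ⟨Ab, -, hAb⟩ := exists_abs_le_of_tendsto hAlim
  obtain ⟨Bb, -, hBb⟩ := exists_abs_le_of_tendsto hBlim
  obtain ⟨R, -, hR⟩ := exists_ae_abs_le hmom hdeg hlc horth
    (fun n => by rw [← hA]; exact hAb n) (fun n => by rw [← hB]; exact hBb n)
  obtain ⟨C, hC⟩ := isCompact_Icc.exists_bound_of_continuousOn (hF.continuousOn (s := Icc (-R) R))
  exact Integrable.of_bound hF.aestronglyMeasurable C
    (hR.mono fun ω hω => hC ω (abs_le.1 hω |> fun h => ⟨h.1, h.2⟩))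

include hS in
/-- `∫ f S_n dτ → π⁻¹ ∫₀^π f(cos θ) sin² θ dθ` for continuous `f` (from the weak limits with
`k = 0, 2` and `S_n = a (p_{n+1}² - p_{n+2} p_n)`, `½(1 - cos 2θ) = sin² θ`). [folklore] -/
theorem tendsto_integral_mul_S {f : ℝ → ℝ} (hf : Continuous f) :
    Tendsto (fun n => ∫ ω, f ω * S n ω ∂τ) atTop
      (𝓝 (π⁻¹ * ∫ θ in (0 : ℝ)..π, f (Real.cos θ) * Real.sin θ ^ 2)) := by
  -- the two weak limits
  have h0 : Tendsto (fun n => ∫ ω, f ω * ((p (n + 1)).eval ω * (p (n + 1)).eval ω) ∂τ) atTop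
      (𝓝 (π⁻¹ * ∫ θ in (0 : ℝ)..π, f (Real.cos θ) * Real.cos ((0 : ℕ) * θ))) :=
    (tendsto_integral_continuous_mul hmom hdeg hlc horth hA hB hAlim hBlim hf 0).congr
      fun n => by simp only [add_zero]
  have h2' : Tendsto (fun n => ∫ ω, f ω * ((p (n + 1)).eval ω * (p (n + 1 + 2)).eval ω) ∂τ)
      atTop (𝓝 (π⁻¹ * ∫ θ in (0 : ℝ)..π, f (Real.cos θ) * Real.cos ((2 : ℕ) * θ))) :=
    tendsto_integral_continuous_mul hmom hdeg hlc horth hA hB hAlim hBlim hf 2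
  have h2 : Tendsto (fun n => ∫ ω, f ω * ((p n).eval ω * (p (n + 2)).eval ω) ∂τ)
      atTop (𝓝 (π⁻¹ * ∫ θ in (0 : ℝ)..π, f (Real.cos θ) * Real.cos ((2 : ℕ) * θ))) :=
    (tendsto_add_atTop_iff_nat (f := fun n => ∫ ω, f ω * ((p n).eval ω *
      (p (n + 2)).eval ω) ∂τ) 1).1 (h2'.congr fun n => by simp only [add_assoc])
  have hA1 : Tendsto (fun n => A (n + 1)) atTop (𝓝 (1 / 2)) := (tendsto_add_atTop_iff_nat 1).2 hAlim
  have T := hA1.mul (h0.sub h2)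
  -- identify the limit
  have e : (1 / 2 : ℝ) * ((π⁻¹ * ∫ θ in (0 : ℝ)..π, f (Real.cos θ) * Real.cos ((0 : ℕ) * θ)) -
      π⁻¹ * ∫ θ in (0 : ℝ)..π, f (Real.cos θ) * Real.cos ((2 : ℕ) * θ)) =
      π⁻¹ * ∫ θ in (0 : ℝ)..π, f (Real.cos θ) * Real.sin θ ^ 2 := by
    have hc0 : Continuous fun θ => f (Real.cos θ) * Real.cos ((0 : ℕ) * θ) := by fun_prop
    have hc2 : Continuous fun θ => f (Real.cos θ) * Real.cos ((2 : ℕ) * θ) := by fun_prop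
    rw [← mul_sub, ← intervalIntegral.integral_sub (hc0.intervalIntegrable _ _)
      (hc2.intervalIntegrable _ _), ← mul_assoc, mul_comm (1 / 2 : ℝ), mul_assoc,
      ← intervalIntegral.integral_const_mul]
    congr 1
    refine intervalIntegral.integral_congr fun θ _ => ?_
    simp only [Nat.cast_ofNat, Nat.cast_zero, zero_mul, Real.cos_zero]
    rw [Real.cos_two_mul, Real.sin_sq]; ring
  rw [← e]
  refine T.congr fun n => ?_
  have i1 := integrable_continuous hmom hdeg hlc horth hA hB hAlim hBlim
    (show Continuous fun ω => f ω * ((p (n + 1)).eval ω * (p (n + 1)).eval ω) by fun_prop)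
  have i2 := integrable_continuous hmom hdeg hlc horth hA hB hAlim hBlim
    (show Continuous fun ω => f ω * ((p n).eval ω * (p (n + 2)).eval ω) by fun_prop)
  rw [← integral_sub i1 i2, ← integral_const_mul]
  refine integral_congr_ae (Eventually.of_forall fun ω => ?_)
  simp only [S_eq_turan hmom hdeg hlc horth hA hB hS n ω]
  ring

end Identification

section Identification2

variable (hmom : ∀ k : ℕ, Integrable (fun ω : ℝ => ω ^ k) τ)
  (hdeg : ∀ n, (p n).natDegree = n) (hlc : ∀ n, 0 < (p n).leadingCoeff)
  (horth : ∀ m n, ∫ ω, (p m).eval ω * (p n).eval ω ∂τ = if m = n then 1 else 0)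
  {A B : ℕ → ℝ} (hA : ∀ n, A n = (p n).leadingCoeff / (p (n + 1)).leadingCoeff)
  (hB : ∀ n, B n = ∫ ω, ω * ((p n).eval ω) ^ 2 ∂τ)
  {S : ℕ → ℝ → ℝ} (hS : ∀ n x, S n x = A (n + 1) * ((p (n + 1)).eval x) ^ 2 -
    (x - B (n + 1)) * ((p (n + 1)).eval x * (p n).eval x) + A n * ((p n).eval x) ^ 2)
  (hAlim : Tendsto A atTop (𝓝 (1 / 2))) (hBlim : Tendsto B atTop (𝓝 0))
  (hAbv : Summable (fun n => |A (n + 1) - A n|)) (hBbv : Summable (fun n => |B (n + 1) - B n|))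
include hmom hdeg hlc horth hA hB hS hAlim hBlim hAbv hBbv

/-- For `f` continuous and supported in `[-r, r]`, `r < 1`: `f · S∞` is continuous on `ℝ`.
[folklore] -/
theorem continuous_mul_Sinf {f : ℝ → ℝ} (hf : Continuous f) {r : ℝ} (hr : r < 1)
    (hfr : ∀ x, r < |x| → f x = 0) :
    Continuous fun x => f x * limUnder atTop (fun n => S n x) := by
  obtain ⟨hcont, -, -⟩ := S_limit hmom hdeg hlc horth hA hB hS hAlim hBlim hAbv hBbv
  rw [continuous_iff_continuousAt]
  intro x₀
  by_cases hx₀ : |x₀| < 1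
  · have hmem : Ioo (-1 : ℝ) 1 ∈ 𝓝 x₀ :=
      isOpen_Ioo.mem_nhds ⟨by linarith [(abs_lt.1 hx₀).1], (abs_lt.1 hx₀).2⟩
    exact hf.continuousAt.mul (hcont.continuousAt hmem)
  · -- near `x₀` the function vanishes identically
    have hmem : {x : ℝ | r < |x|} ∈ 𝓝 x₀ :=
      (isOpen_lt continuous_const continuous_abs).mem_nhds (by
        simp only [mem_setOf_eq]; linarith [not_lt.1 hx₀])
    refine Filter.EventuallyEq.continuousAt (y := 0) ?_
    filter_upwards [hmem] with x hx
    rw [hfr x hx, zero_mul]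

/-- **Step 1 of the identification**: for `f` continuous and supported in `[-r, r]`, `r < 1`,
`∫ f S_n dτ → ∫ f S∞ dτ` (uniform convergence of `S_n` on `[-r, r]`). [folklore] -/
theorem tendsto_integral_mul_S_Sinf {f : ℝ → ℝ} (hf : Continuous f) {r : ℝ} (hr0 : 0 ≤ r)
    (hr : r < 1) (hfr : ∀ x, r < |x| → f x = 0) :
    Tendsto (fun n => ∫ ω, f ω * S n ω ∂τ) atTop
      (𝓝 (∫ ω, f ω * limUnder atTop (fun n => S n ω) ∂τ)) := by
  haveI := isFiniteMeasure_of_moments hmom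
  obtain ⟨-, -, hunif⟩ := S_limit hmom hdeg hlc horth hA hB hS hAlim hBlim hAbv hBbv
  obtain ⟨N, ρ, hρ, hb⟩ := hunif r hr0 hr
  -- `f` is bounded
  obtain ⟨C₀, hC₀⟩ := isCompact_Icc.exists_bound_of_continuousOn (hf.continuousOn (s := Icc (-r) r))
  set C := max C₀ 0 with hC
  have hfC : ∀ x, |f x| ≤ C := fun x => by
    by_cases hx : |x| ≤ r
    · exact ((Real.norm_eq_abs _).symm.le.trans (hC₀ x ⟨(abs_le.1 hx).1, (abs_le.1 hx).2⟩)).trans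
        (le_max_left _ _)
    · rw [hfr x (not_le.1 hx), abs_zero]; exact le_max_right _ _
  have hfS : ∀ n, Integrable (fun ω => f ω * S n ω) τ := fun n =>
    integrable_continuous hmom hdeg hlc horth hA hB hAlim hBlim (hf.mul (by
      rw [show S n = _ from funext (hS n)]; fun_prop))
  have hfSinf : Integrable (fun ω => f ω * limUnder atTop (fun n => S n ω)) τ :=
    integrable_continuous hmom hdeg hlc horth hA hB hAlim hBlim
      (continuous_mul_Sinf hmom hdeg hlc horth hA hB hS hAlim hBlim hAbv hBbv hf hr hfr)
  rw [← tendsto_sub_nhds_zero_iff]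
  refine squeeze_zero_norm' (a := fun n => C * |ρ n| * τ.real univ)
    (eventually_atTop.2 ⟨N, fun n hn => ?_⟩) ?_
  · rw [← integral_sub (hfS n) hfSinf]
    have hbound : ∀ᵐ ω ∂τ, ‖f ω * S n ω - f ω * limUnder atTop (fun n => S n ω)‖ ≤ C * |ρ n| :=
      Eventually.of_forall fun ω => by
        rw [Real.norm_eq_abs, ← mul_sub, abs_mul]
        by_cases hω : |ω| ≤ r
        · exact mul_le_mul (hfC ω) ((hb n hn ω hω).trans (le_abs_self _)) (abs_nonneg _)
            (le_max_right _ _)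
        · rw [hfr ω (not_le.1 hω), abs_zero, zero_mul]; positivity
    refine (norm_integral_le_of_norm_le (integrable_const _) hbound).trans (le_of_eq ?_)
    rw [integral_const, smul_eq_mul]; ring
  · have : Tendsto (fun n => C * |ρ n| * τ.real univ) atTop (𝓝 (C * |0| * τ.real univ)) :=
      ((hρ.abs.const_mul C).mul_const _)
    simpa using this

/-- **Step 2 of the identification** (Máté–Nevai; Dombrowski–Nevai (12)): for `f` continuous
and supported in `[-r, r]`, `r < 1`,
`∫ f S∞ dτ = π⁻¹ ∫₀^π f(cos θ) sin² θ dθ = π⁻¹ ∫_{-1}^1 f(x) √(1-x²) dx`.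
[cite: DombrowskiNevai1986, Thm 1 (12)] -/
theorem integral_mul_Sinf {f : ℝ → ℝ} (hf : Continuous f) {r : ℝ} (hr0 : 0 ≤ r)
    (hr : r < 1) (hfr : ∀ x, r < |x| → f x = 0) :
    ∫ ω, f ω * limUnder atTop (fun n => S n ω) ∂τ =
      π⁻¹ * ∫ x in (-1 : ℝ)..1, f x * Real.sqrt (1 - x ^ 2) := by
  rw [← integral_comp_cos_mul_sin_sq hf]
  exact tendsto_nhds_unique
    (tendsto_integral_mul_S_Sinf hmom hdeg hlc horth hA hB hS hAlim hBlim hAbv hBbv hf hr0 hr hfr)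
    (tendsto_integral_mul_S hmom hdeg hlc horth hA hB hS hAlim hBlim hf)

/-- **The density identity against test functions**: for `f` continuous, supported in
`[-r, r]`, `r < 1`: `∫ f dτ = ∫_{-1}^1 f(x) g(x) dx` with `g = √(1-x²) / (π S∞)`.
[cite: DombrowskiNevai1986, Thm 1 (12)] -/
theorem integral_eq_integral_mul_density {f : ℝ → ℝ} (hf : Continuous f) {r : ℝ} (hr0 : 0 ≤ r)
    (hr : r < 1) (hfr : ∀ x, r < |x| → f x = 0) :
    ∫ ω, f ω ∂τ = ∫ x in (-1 : ℝ)..1,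
      f x * (Real.sqrt (1 - x ^ 2) / (π * limUnder atTop (fun n => S n x))) := by
  obtain ⟨hcont, hpos, -⟩ := S_limit hmom hdeg hlc horth hA hB hS hAlim hBlim hAbv hBbv
  -- the clamp `cl x = max (-r) (min r x) ∈ [-r, r]`
  have hcl_mem : ∀ x, max (-r) (min r x) ∈ Icc (-r) r := fun x =>
    ⟨le_max_left _ _, max_le (by linarith) (min_le_left _ _)⟩
  have hcl_id : ∀ x, |x| ≤ r → max (-r) (min r x) = x := fun x hx => by
    rw [min_eq_right (abs_le.1 hx).2, max_eq_right (abs_le.1 hx).1]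
  have hIcc : Icc (-r) r ⊆ Ioo (-1 : ℝ) 1 := fun x hx => ⟨by linarith [hx.1], by linarith [hx.2]⟩
  have hclc : Continuous fun x : ℝ => max (-r) (min r x) := by fun_prop
  have hSc : Continuous fun x => limUnder atTop (fun n => S n (max (-r) (min r x))) :=
    (hcont.mono hIcc).comp_continuous hclc hcl_mem
  have hSc_pos : ∀ x, 0 < limUnder atTop (fun n => S n (max (-r) (min r x))) := fun x =>
    hpos _ (hIcc (hcl_mem x))
  -- `F = f / (S∞ ∘ cl)` is continuous, supported in `[-r, r]`
  have hFc : Continuous fun x => f x / limUnder atTop (fun n => S n (max (-r) (min r x))) :=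
    hf.div hSc fun x => (hSc_pos x).ne'
  have hFr : ∀ x, r < |x| → f x / limUnder atTop (fun n => S n (max (-r) (min r x))) = 0 :=
    fun x hx => by rw [hfr x hx, zero_div]
  have key := integral_mul_Sinf hmom hdeg hlc horth hA hB hS hAlim hBlim hAbv hBbv hFc hr0 hr hFr
  -- left-hand side: `F · S∞ = f`
  have e1 : ∀ x, f x / limUnder atTop (fun n => S n (max (-r) (min r x))) *
      limUnder atTop (fun n => S n x) = f x := fun x => by
    by_cases hx : |x| ≤ r
    · rw [hcl_id x hx]
      exact div_mul_cancel₀ _ (hpos x (hIcc ⟨(abs_le.1 hx).1, (abs_le.1 hx).2⟩)).ne'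
    · rw [hfr x (not_le.1 hx), zero_div, zero_mul]
  -- right-hand side
  have e2 : ∀ x, π⁻¹ * (f x / limUnder atTop (fun n => S n (max (-r) (min r x))) *
      Real.sqrt (1 - x ^ 2)) =
      f x * (Real.sqrt (1 - x ^ 2) / (π * limUnder atTop (fun n => S n x))) := fun x => by
    by_cases hx : |x| ≤ r
    · rw [hcl_id x hx]
      simp only [div_eq_mul_inv, mul_inv]
      ring
    · rw [hfr x (not_le.1 hx), zero_div, zero_mul, zero_mul, mul_zero]
  simp only [e1] at key
  rw [key, ← intervalIntegral.integral_const_mul]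
  exact intervalIntegral.integral_congr fun x _ => e2 x

end Identification2

/-! ### From test functions to measures: bump functions and interval measures -/

section Bump

/-- The bump `φ_m(x) = max(0, min(1, m · min(x-α, β-x)))` is continuous. [folklore] -/
theorem bump_continuous (α β : ℝ) (m : ℕ) :
    Continuous fun x : ℝ => max 0 (min 1 ((m : ℝ) * min (x - α) (β - x))) := by fun_prop

/-- `0 ≤ φ_m`. [folklore] -/
theorem bump_nonneg (α β x : ℝ) (m : ℕ) : 0 ≤ max 0 (min 1 ((m : ℝ) * min (x - α) (β - x))) :=
  le_max_left _ _

/-- `φ_m ≤ 1`. [folklore] -/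
theorem bump_le_one (α β x : ℝ) (m : ℕ) : max 0 (min 1 ((m : ℝ) * min (x - α) (β - x))) ≤ 1 :=
  max_le zero_le_one (min_le_left _ _)

/-- `φ_m` vanishes off `(α, β)`. [folklore] -/
theorem bump_eq_zero {α β x : ℝ} (hx : x ∉ Ioo α β) (m : ℕ) :
    max 0 (min 1 ((m : ℝ) * min (x - α) (β - x))) = 0 := by
  have h1 : min (x - α) (β - x) ≤ 0 := by
    simp only [mem_Ioo, not_and_or, not_lt] at hx
    rcases hx with h | h
    · exact (min_le_left _ _).trans (by linarith)
    · exact (min_le_right _ _).trans (by linarith)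
  have h2 : (m : ℝ) * min (x - α) (β - x) ≤ 0 := mul_nonpos_iff.2 (Or.inl ⟨Nat.cast_nonneg m, h1⟩)
  exact max_eq_left ((min_le_right _ _).trans h2)

/-- `φ_m` is increasing in `m`. [folklore] -/
theorem bump_mono (α β x : ℝ) :
    Monotone fun m : ℕ => max 0 (min 1 ((m : ℝ) * min (x - α) (β - x))) := by
  intro m m' hmm'
  by_cases hx : x ∈ Ioo α β
  · have ht : 0 ≤ min (x - α) (β - x) := le_min (by linarith [hx.1]) (by linarith [hx.2])
    have h : (m : ℝ) * min (x - α) (β - x) ≤ (m' : ℝ) * min (x - α) (β - x) :=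
      mul_le_mul_of_nonneg_right (Nat.cast_le.2 hmm') ht
    exact max_le_max le_rfl (min_le_min le_rfl h)
  · simp only [bump_eq_zero hx, le_refl]

/-- `sup_m φ_m = 1_{(α, β)}` (in `ℝ≥0∞`). [folklore] -/
theorem iSup_bump (α β x : ℝ) :
    ⨆ m : ℕ, ENNReal.ofReal (max 0 (min 1 ((m : ℝ) * min (x - α) (β - x)))) =
      (Ioo α β).indicator 1 x := by
  by_cases hx : x ∈ Ioo α β
  · rw [indicator_of_mem hx, Pi.one_apply]
    have ht : 0 < min (x - α) (β - x) := lt_min (by linarith [hx.1]) (by linarith [hx.2])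
    obtain ⟨m, hm⟩ := exists_nat_ge (1 / min (x - α) (β - x))
    refine le_antisymm (iSup_le fun k => ?_) (le_iSup_of_le m ?_)
    · rw [← ENNReal.ofReal_one]; exact ENNReal.ofReal_le_ofReal (bump_le_one α β x k)
    · have h1 : 1 ≤ (m : ℝ) * min (x - α) (β - x) := by rw [div_le_iff₀ ht] at hm; linarith
      rw [min_eq_left h1, max_eq_right zero_le_one, ENNReal.ofReal_one]
  · rw [indicator_of_notMem hx]
    simp only [bump_eq_zero hx, ENNReal.ofReal_zero, ciSup_const]

end Bump

section MeasureExt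

variable {g : ℝ → ℝ} (hg : ContinuousOn g (Ioo (-1) 1)) (hg0 : ∀ x ∈ Ioo (-1 : ℝ) 1, 0 ≤ g x)
  (hkey : ∀ (f : ℝ → ℝ) (r : ℝ), Continuous f → 0 ≤ r → r < 1 → (∀ x, r < |x| → f x = 0) →
    ∫ ω, f ω ∂τ = ∫ x in (-1 : ℝ)..1, f x * g x)
include hg hg0 hkey

/-- If `∫ f dτ = ∫_{-1}^1 f g dx` for all continuous `f` compactly supported in `(-1, 1)`, then
`τ(α, β) = ∫_{(α,β)} g dx` for `[α, β] ⊂ (-1, 1)` (monotone convergence along the bumps `φ_m`).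
[folklore] -/
theorem measure_Ioo_eq_lintegral_of_lt [IsFiniteMeasure τ] {α β : ℝ} (hα : -1 < α) (hαβ : α < β)
    (hβ : β < 1) : τ (Ioo α β) = ∫⁻ x in Ioo α β, ENNReal.ofReal (g x) := by
  set φ : ℕ → ℝ → ℝ := fun m x => max 0 (min 1 ((m : ℝ) * min (x - α) (β - x))) with hφ
  set r := max |α| |β| with hr
  have hr0 : 0 ≤ r := (abs_nonneg α).trans (le_max_left _ _)
  have hr1 : r < 1 := max_lt (abs_lt.2 ⟨by linarith, by linarith⟩) (abs_lt.2 ⟨by linarith, hβ⟩)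
  have hout : ∀ x, r < |x| → x ∉ Ioo α β := fun x hx hmem => by
    have hxa : |α| < |x| := lt_of_le_of_lt (le_max_left _ _) hx
    have hxb : |β| < |x| := lt_of_le_of_lt (le_max_right _ _) hx
    rcases le_or_gt 0 x with h | h
    · rw [abs_of_nonneg h] at hxb; linarith [le_abs_self β, hmem.2]
    · rw [abs_of_neg h] at hxa; linarith [neg_abs_le α, hmem.1]
  have hφr : ∀ m x, r < |x| → φ m x = 0 := fun m x hx => bump_eq_zero (hout x hx) m
  have hIoo : Ioo α β ⊆ Ioo (-1 : ℝ) 1 := Ioo_subset_Ioo hα.le hβ.le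
  have hIcc : Icc α β ⊆ Ioo (-1 : ℝ) 1 := fun x hx => ⟨by linarith [hx.1], by linarith [hx.2]⟩
  -- (A) `τ (α, β) = sup_m ∫ φ_m dτ`
  have hmeas : ∀ m, Measurable fun x => ENNReal.ofReal (φ m x) := fun m =>
    (bump_continuous α β m).measurable.ennreal_ofReal
  have hA : τ (Ioo α β) = ⨆ m, ∫⁻ x, ENNReal.ofReal (φ m x) ∂τ := by
    rw [← lintegral_iSup hmeas (fun m m' h x => ENNReal.ofReal_le_ofReal (bump_mono α β x h)),
      ← lintegral_indicator_one measurableSet_Ioo]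
    exact lintegral_congr fun x => (iSup_bump α β x).symm
  -- (B) `∫ φ_m dτ = ∫_{(-1,1)} φ_m g dx`
  obtain ⟨G₀, hG₀⟩ := isCompact_Icc.exists_bound_of_continuousOn (hg.mono hIcc)
  set G := max G₀ 0 with hG
  have hB : ∀ m, ∫⁻ x, ENNReal.ofReal (φ m x) ∂τ =
      ∫⁻ x in Ioo (-1) 1, ENNReal.ofReal (φ m x * g x) := by
    intro m
    have hφi : Integrable (φ m) τ :=
      Integrable.of_bound (bump_continuous α β m).aestronglyMeasurable 1
        (Eventually.of_forall fun x => by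
          rw [Real.norm_eq_abs, abs_of_nonneg (bump_nonneg α β x m)]; exact bump_le_one α β x m)
    have hcont : ContinuousOn (fun x => φ m x * g x) (Ioo (-1) 1) :=
      (bump_continuous α β m).continuousOn.mul hg
    have hbound : ∀ x ∈ Ioo (-1 : ℝ) 1, ‖φ m x * g x‖ ≤ G := fun x hx => by
      by_cases hmem : x ∈ Ioo α β
      · rw [norm_mul, Real.norm_eq_abs, abs_of_nonneg (bump_nonneg α β x m)]
        calc φ m x * ‖g x‖ ≤ 1 * G₀ :=
              mul_le_mul (bump_le_one α β x m) (hG₀ x ⟨hmem.1.le, hmem.2.le⟩) (norm_nonneg _)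
                zero_le_one
          _ ≤ G := by rw [one_mul]; exact le_max_left _ _
      · rw [show φ m x = 0 from bump_eq_zero hmem m, zero_mul, norm_zero]; exact le_max_right _ _
    have hint : IntegrableOn (fun x => φ m x * g x) (Ioo (-1) 1) volume :=
      IntegrableOn.of_bound measure_Ioo_lt_top (hcont.aestronglyMeasurable measurableSet_Ioo) G
        ((ae_restrict_mem measurableSet_Ioo).mono hbound)
    have hnn : 0 ≤ᵐ[volume.restrict (Ioo (-1) 1)] fun x => φ m x * g x :=
      (ae_restrict_mem measurableSet_Ioo).mono fun x hx =>
        mul_nonneg (bump_nonneg α β x m) (hg0 x hx)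
    rw [← ofReal_integral_eq_lintegral_ofReal hφi
        (Eventually.of_forall fun x => bump_nonneg α β x m),
      hkey (φ m) r (bump_continuous α β m) hr0 hr1 (hφr m),
      intervalIntegral.integral_of_le (by norm_num : (-1 : ℝ) ≤ 1), integral_Ioc_eq_integral_Ioo,
      ofReal_integral_eq_lintegral_ofReal hint hnn]
  -- (C) `sup_m ∫_{(-1,1)} φ_m g dx = ∫_{(α,β)} g dx`
  have hC : (⨆ m, ∫⁻ x in Ioo (-1) 1, ENNReal.ofReal (φ m x * g x)) =
      ∫⁻ x in Ioo α β, ENNReal.ofReal (g x) := by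
    have hmeas' : ∀ m, AEMeasurable (fun x => ENNReal.ofReal (φ m x * g x))
        (volume.restrict (Ioo (-1) 1)) := fun m =>
      (((bump_continuous α β m).continuousOn.mul hg).aemeasurable measurableSet_Ioo).ennreal_ofReal
    have hmono : ∀ᵐ x ∂(volume.restrict (Ioo (-1 : ℝ) 1)),
        Monotone fun m => ENNReal.ofReal (φ m x * g x) :=
      (ae_restrict_mem measurableSet_Ioo).mono fun x hx m m' h =>
        ENNReal.ofReal_le_ofReal (mul_le_mul_of_nonneg_right (bump_mono α β x h) (hg0 x hx))
    rw [← lintegral_iSup' hmeas' hmono]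
    have e : EqOn (fun x => ⨆ m, ENNReal.ofReal (φ m x * g x))
        ((Ioo α β).indicator fun x => ENNReal.ofReal (g x)) (Ioo (-1) 1) := fun x hx => by
      have h1 : ∀ m, ENNReal.ofReal (φ m x * g x) =
          ENNReal.ofReal (φ m x) * ENNReal.ofReal (g x) := fun m =>
        ENNReal.ofReal_mul (bump_nonneg α β x m)
      simp only [h1]
      rw [← ENNReal.iSup_mul, iSup_bump]
      by_cases hmem : x ∈ Ioo α β
      · simp [indicator_of_mem hmem]
      · simp [indicator_of_notMem hmem]
    rw [setLIntegral_congr_fun measurableSet_Ioo e, lintegral_indicator measurableSet_Ioo,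
      Measure.restrict_restrict measurableSet_Ioo, inter_eq_left.2 hIoo]
  rw [hA]
  simp only [hB]
  exact hC

/-- Extension to all subintervals of `[-1, 1]` by continuity from below. [folklore] -/
theorem measure_Ioo_eq_lintegral [IsFiniteMeasure τ] {a b : ℝ} (ha : -1 ≤ a) (hab : a < b)
    (hb : b ≤ 1) : τ (Ioo a b) = ∫⁻ x in Ioo a b, ENNReal.ofReal (g x) := by
  have hac : a < (a + b) / 2 := by linarith
  have hcb : (a + b) / 2 < b := by linarith
  obtain ⟨u, hu_anti, hu_mem, hu_lim⟩ := exists_seq_strictAnti_tendsto' hac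
  obtain ⟨v, hv_mono, hv_mem, hv_lim⟩ := exists_seq_strictMono_tendsto' hcb
  have hs_mono : Monotone fun n => Ioo (u n) (v n) := fun m n hmn =>
    Ioo_subset_Ioo (hu_anti.antitone hmn) (hv_mono.monotone hmn)
  have hunion : ⋃ n, Ioo (u n) (v n) = Ioo a b := by
    refine Subset.antisymm (iUnion_subset fun n => Ioo_subset_Ioo (hu_mem n).1.le (hv_mem n).2.le)
      fun x hx => ?_
    have h1 : ∀ᶠ n in atTop, u n < x := (tendsto_order.1 hu_lim).2 x hx.1
    have h2 : ∀ᶠ n in atTop, x < v n := (tendsto_order.1 hv_lim).1 x hx.2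
    obtain ⟨n, hn1, hn2⟩ := (h1.and h2).exists
    exact mem_iUnion.2 ⟨n, hn1, hn2⟩
  have e : ∀ n, τ (Ioo (u n) (v n)) = ∫⁻ x in Ioo (u n) (v n), ENNReal.ofReal (g x) := fun n =>
    measure_Ioo_eq_lintegral_of_lt hg hg0 hkey (by linarith [(hu_mem n).1])
      ((hu_mem n).2.trans (hv_mem n).1) (by linarith [(hv_mem n).2])
  rw [← hunion, hs_mono.measure_iUnion, ← withDensity_apply _ (MeasurableSet.iUnion fun n =>
    measurableSet_Ioo), hs_mono.measure_iUnion]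
  simp only [withDensity_apply _ measurableSet_Ioo, e]

/-- **The measure identification**: `τ|_{(-1,1)} = g dx|_{(-1,1)}`. [folklore] -/
theorem restrict_Ioo_eq_withDensity [IsFiniteMeasure τ] :
    τ.restrict (Ioo (-1) 1) =
      (volume.restrict (Ioo (-1) 1)).withDensity (fun x => ENNReal.ofReal (g x)) := by
  refine Real.measure_ext_Ioo_rat fun a b => ?_
  rw [Measure.restrict_apply measurableSet_Ioo, withDensity_apply _ measurableSet_Ioo,
    Measure.restrict_restrict measurableSet_Ioo, Ioo_inter_Ioo]
  rcases le_or_gt (min (b : ℝ) 1) (max (a : ℝ) (-1)) with h | h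
  · rw [Ioo_eq_empty (not_lt.2 h), measure_empty, Measure.restrict_empty, lintegral_zero_measure]
  · exact measure_Ioo_eq_lintegral hg hg0 hkey (le_max_right _ _) h (min_le_right _ _)

end MeasureExt

end MateNevai

/-! ### Assembly -/

open MateNevai in
/-- **The Máté–Nevai bounded-variation theorem** — discharge of the named fact
`MateNevaiBoundedVariation` (Máté–Nevai 1983 = Van Assche, LNM 1265, Thm 2.27; proof along
Dombrowski–Nevai 1986, (3), (4), Lemma 1, Thm 1): the density is
`g(x) = √(1 - x²) / (π S∞(x))`, `S∞ = lim aₙ₊₂ (pₙ₊₁² - pₙ₊₂ pₙ)` the limit of the Turán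
determinants. [cite: VanAssche1987, Thm 2.27] -/
theorem MateNevaiBoundedVariation_holds : MateNevaiBoundedVariation := by
  intro τ hmom p hdeg hlc horth hAlim hBlim hAbv hBbv
  haveI := isFiniteMeasure_of_moments hmom
  -- the Jacobi coefficients and the Turán determinants
  set A : ℕ → ℝ := fun n => (p n).leadingCoeff / (p (n + 1)).leadingCoeff with hAdef
  set B : ℕ → ℝ := fun n => ∫ ω, ω * ((p n).eval ω) ^ 2 ∂τ with hBdef
  have hA : ∀ n, A n = (p n).leadingCoeff / (p (n + 1)).leadingCoeff := fun n => rfl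
  have hB : ∀ n, B n = ∫ ω, ω * ((p n).eval ω) ^ 2 ∂τ := fun n => rfl
  set S : ℕ → ℝ → ℝ := fun n x => A (n + 1) * ((p (n + 1)).eval x) ^ 2 -
    (x - B (n + 1)) * ((p (n + 1)).eval x * (p n).eval x) + A n * ((p n).eval x) ^ 2 with hSdef
  have hS : ∀ n x, S n x = A (n + 1) * ((p (n + 1)).eval x) ^ 2 -
      (x - B (n + 1)) * ((p (n + 1)).eval x * (p n).eval x) + A n * ((p n).eval x) ^ 2 :=
    fun n x => rfl
  have hAlim' : Tendsto A atTop (𝓝 (1 / 2)) := hAlim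
  have hBlim' : Tendsto B atTop (𝓝 0) := hBlim
  have hAbv' : Summable (fun n => |A (n + 1) - A n|) := hAbv
  have hBbv' : Summable (fun n => |B (n + 1) - B n|) := hBbv
  obtain ⟨hcont, hpos, -⟩ := S_limit hmom hdeg hlc horth hA hB hS hAlim' hBlim' hAbv' hBbv'
  -- the density
  set g : ℝ → ℝ := fun x => Real.sqrt (1 - x ^ 2) / (π * limUnder atTop (fun n => S n x)) with hg
  have hgc : ContinuousOn g (Ioo (-1) 1) := by
    refine ContinuousOn.div (by fun_prop) (continuousOn_const.mul hcont) fun x hx => ?_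
    exact mul_ne_zero Real.pi_pos.ne' (hpos x hx).ne'
  have hgpos : ∀ x ∈ Ioo (-1 : ℝ) 1, 0 < g x := fun x hx => by
    refine div_pos (Real.sqrt_pos.2 ?_) (mul_pos Real.pi_pos (hpos x hx))
    have : |x| < 1 := abs_lt.2 ⟨hx.1, hx.2⟩
    nlinarith [abs_nonneg x, sq_abs x]
  refine ⟨g, hgc, hgpos, ?_⟩
  exact restrict_Ioo_eq_withDensity hgc (fun x hx => (hgpos x hx).le)
    fun f r hf hr0 hr1 hfr => integral_eq_integral_mul_density hmom hdeg hlc horth hA hB hS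
      hAlim' hBlim' hAbv' hBbv' hf hr0 hr1 hfr

/-- **Discharge of the even-measure corollary** `MateNevaiBoundedVariationEven` (the case
`b_n ≡ 0` of the Máté–Nevai theorem — automatic for an even measure — transported along
`x ↦ W x`): unconditional now that `MateNevaiBoundedVariation_holds` is proved, via the reduction
`mateNevaiBoundedVariationEven_of` of the fact file. [cite: VanAssche1987, Thm 2.27 (case b_n = 0)] -/
theorem MateNevaiBoundedVariationEven_holds : MateNevaiBoundedVariationEven :=
  mateNevaiBoundedVariationEven_of MateNevaiBoundedVariation_holds

end Literature.Analysis.Approximation
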